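import Literature.Analysis.FluidPDE.NSHopfGalerkin
import Literature.Analysis.FunctionSpaces.TorusSpaceTimeFields
import Literature.Analysis.FunctionSpaces.TorusSpectralWeakDerivative
import HarnessLib

/-!
# Navier–Stokes on `𝕋³`: compactness of a Hopf–Galerkin scheme and its limit field
  (proof of the named fact `NS.hopf_galerkin_limit`, parts 1–2 of 4)

Trunk: FluidKinetic. First module of the proof of `NS.hopf_galerkin_limit`
(`Literature/Analysis/FluidPDE/NSHopfGalerkin`; Hopf 1951, §4; Robinson–Rodrigo–Sadowski 2016,
Thm. 4.4 Steps 3–4, Thm. 4.11, Exercises 4.2–4.9; Constantin–Foias 1988, Ch. 8, (8.10)–(8.17),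
Lemma 8.4), on the Fourier side, in two parts with their own section documentation below:

1. **Compactness** — uniform bounds from the energy identity, equicontinuity of the Fourier
   coefficients from the tested Galerkin equations, diagonal extraction (Tychonoff at rational
   times) and the limit coefficients;
2. **The limit field** — Riesz–Fischer with an everywhere-in-time representative, transversality
   (weak divergence-freeness), the uniform `L²` bound, Fatou for the dissipation, and Friedrichs'
   inequality (strong convergence in `L²((0,T) × T^d)`).

The sequels are `NSHopfEnergy` (energy inequalities, weak continuity, energy class) and
`NSHopfGalerkinLimit` (weak form of the equations, assembly). Theorem-only module.

## References

* E. Hopf, *Über die Anfangswertaufgabe für die hydrodynamischen Grundgleichungen*, Math. Nachr.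
  4 (1951), 213–231, §4.
* J. C. Robinson, J. L. Rodrigo, W. Sadowski, *The three-dimensional Navier–Stokes equations*
  (CUP 2016), Lemma 2.3, Thm. 4.4 Step 3 (4.8)–(4.13), Thm. 4.11 (pp. 82–84), Exercises 4.2–4.9.
* P. Constantin, C. Foias, *Navier–Stokes Equations* (Chicago 1988), Ch. 8, (8.10)–(8.17),
  Lemma 8.4.
-/

/-!
# Part 1 — uniform bounds, equicontinuity and compactness of a Hopf–Galerkin scheme

Trunk: FluidKinetic. First half of the proof of the named fact `NS.hopf_galerkin_limit`
(`Literature/Analysis/FluidPDE/NSHopfGalerkin`): the a priori estimates and the compactness step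
of Hopf's existence proof, carried out — as in Hopf's original argument — entirely on the Fourier
side (Hopf 1951, §4; Robinson–Rodrigo–Sadowski 2016, Thm. 4.4, Step 3, (4.8)–(4.13), Thm. 4.11
and Exercises 4.2–4.9 "Hopf's method"; Constantin–Foias 1988, Ch. 8, (8.10)–(8.17)).

For a Hopf–Galerkin scheme `(N, F, U)` (`NS.IsHopfGalerkinScheme ν f u₀ N F U`) with `ν ≥ 0`:

* **L1, uniform bounds** (`IsHopfGalerkinScheme.integral_norm_sq_le`,
  `.lintegral_eGradNormSq_le`): from the energy identity and Young's inequality,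
  `sup_{[0,T]} ‖U n‖₂² ≤ 2‖u₀‖₂² + 4T·A_T` and `ν ∫₀ᵀ ‖∇U n‖₂² ≤ ‖u₀‖₂² + 2T·A_T`, where
  `A_T` bounds `∫₀ᵀ ‖F n‖₂²` uniformly in `n` (`IsHopfGalerkinScheme.exists_force_bound`, from
  `F n → f` in `L²ₜL²ₓ`) (RRS (4.8)–(4.9); CF (8.10)–(8.12)).
* **L2, equicontinuity of the Fourier coefficients** (`IsHopfGalerkinScheme.norm_sub_sq_le`):
  testing the Galerkin equations against the single real mode at frequency `k` with vector
  `Û_n(t,k) - Û_n(s,k)` (divergence free because `U n` is) gives the explicit modulus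
  `‖Û_n(t,k) - Û_n(s,k)‖² ≤ C_{k,T} (t - s) + C'_T √(t - s)` on `[0, T]`, uniformly in `n`
  (RRS Ex. 4.2 / (4.12); CF (8.17)).
* **L3, extraction** (`IsHopfGalerkinScheme.exists_subseq_tendsto_mFourierCoeff`): a diagonal
  subsequence along which every Fourier coefficient converges at every rational time
  (Tychonoff over the countable index set `ℚ × ℤ^d`, `IsCompact.tendsto_subseq`), hence — by the
  uniform modulus — at every time `t ≥ 0`, to a limit family `c t k` that is continuous in `t`,
  transversal, conjugate symmetric, square summable with `∑_k ‖c t k‖² ≤ K_T` on `[0, T]`, and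
  with `c 0 = û₀` (RRS Thm. 4.4 Step 3 and Ex. 4.3–4.4; Hopf 1951, §4).

(Part 1; the limit field is built in Part 2.)

## Mathlib search

Mathlib (this pin): `IsCompact.tendsto_subseq` (sequential compactness in first-countable
spaces), `isCompact_univ_pi` (Tychonoff), countable products are first countable; Arzelà–Ascoli
exists for `BoundedContinuousFunction` (`BoundedContinuousFunction.arzela_ascoli`) but the
by-hand "rational times + modulus" route used here avoids repackaging the coefficient curves.
No Navier–Stokes / Galerkin material (searched `Galerkin`, `NavierStokes`: only `Literature/`).

## References

* E. Hopf, *Über die Anfangswertaufgabe für die hydrodynamischen Grundgleichungen*,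
  Math. Nachr. 4 (1951), 213–231, §4.
* J. C. Robinson, J. L. Rodrigo, W. Sadowski, *The three-dimensional Navier–Stokes equations*,
  CUP 2016, Thm. 4.4 Step 3 (pp. 75–76), (4.8)–(4.13), Thm. 4.11 (pp. 82–84),
  Exercises 4.2–4.9 (pp. 85–86).
* P. Constantin, C. Foias, *Navier–Stokes Equations*, Chicago 1988, Ch. 8, (8.10)–(8.17),
  Lemmas 8.2–8.4.
-/

noncomputable section

open MeasureTheory Set Filter Topology UnitAddTorus Function
open scoped ENNReal NNReal InnerProductSpace RealInnerProductSpace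

namespace Literature.Analysis.FluidPDE

variable {d : Type*} [Fintype d] [DecidableEq d]

/-! ## Elementary inequalities -/

section Elementary

omit [Fintype d] [DecidableEq d]

/-- Young's inequality for a real inner product: `⟪a, b⟫ ≤ ‖a‖²/(2η) + (η/2) ‖b‖²`, `η > 0`. [folklore] -/
theorem inner_le_young {E : Type*} [NormedAddCommGroup E] [InnerProductSpace ℝ E] (a b : E)
    {η : ℝ} (hη : 0 < η) : ⟪a, b⟫ ≤ (2 * η)⁻¹ * ‖a‖ ^ 2 + η / 2 * ‖b‖ ^ 2 := by
  have h1 : ⟪a, b⟫ ≤ ‖a‖ * ‖b‖ := real_inner_le_norm a b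
  have h2 : ‖a‖ * ‖b‖ ≤ (2 * η)⁻¹ * ‖a‖ ^ 2 + η / 2 * ‖b‖ ^ 2 := by
    have h := sq_nonneg (η * ‖b‖ - ‖a‖)
    have hη2 : (2 * η)⁻¹ * ‖a‖ ^ 2 + η / 2 * ‖b‖ ^ 2 - ‖a‖ * ‖b‖ =
        (2 * η)⁻¹ * (η * ‖b‖ - ‖a‖) ^ 2 := by
      field_simp
      ring
    have : 0 ≤ (2 * η)⁻¹ * (η * ‖b‖ - ‖a‖) ^ 2 := by positivity
    linarith
  exact h1.trans h2

/-- `‖a‖² ≤ 2‖a - b‖² + 2‖b‖²` in `ℝ≥0∞` (extended norms). [folklore] -/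
theorem enorm_sq_le_two_mul_add {E : Type*} [NormedAddCommGroup E] (a b : E) :
    ‖a‖ₑ ^ 2 ≤ 2 * ‖a - b‖ₑ ^ 2 + 2 * ‖b‖ₑ ^ 2 := by
  have hr : ‖a‖ ^ 2 ≤ 2 * ‖a - b‖ ^ 2 + 2 * ‖b‖ ^ 2 := by
    have h1 : ‖a‖ ≤ ‖a - b‖ + ‖b‖ := norm_le_norm_sub_add a b
    nlinarith [norm_nonneg a, norm_nonneg (a - b), norm_nonneg b, sq_nonneg (‖a - b‖ - ‖b‖)]
  have hl : ‖a‖ₑ ^ 2 = ENNReal.ofReal (‖a‖ ^ 2) := by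
    rw [← ofReal_norm, ENNReal.ofReal_pow (norm_nonneg _)]
  have hr' : (2 : ℝ≥0∞) * ‖a - b‖ₑ ^ 2 + 2 * ‖b‖ₑ ^ 2 =
      ENNReal.ofReal (2 * ‖a - b‖ ^ 2 + 2 * ‖b‖ ^ 2) := by
    rw [ENNReal.ofReal_add (by positivity) (by positivity), ENNReal.ofReal_mul zero_le_two,
      ENNReal.ofReal_mul zero_le_two, ENNReal.ofReal_pow (norm_nonneg _),
      ENNReal.ofReal_pow (norm_nonneg _), ofReal_norm, ofReal_norm, ENNReal.ofReal_ofNat]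
  rw [hl, hr']
  exact ENNReal.ofReal_le_ofReal hr

end Elementary

/-! ## Space–time `L²` bookkeeping for fields with continuous lift -/

section SpaceTimeL2

omit [DecidableEq d]

variable {u v : ℝ → UnitAddTorus d → EuclideanSpace ℝ d}

/-- For a field with space–time lift continuous on `[0, ∞) × ℝ^d`, the slice energy is the
`toReal` of the slice `lintegral`: `ofReal (∫ ‖u t‖²) = ∫⁻ ‖u t‖ₑ²`, `t ≥ 0`. [folklore] -/
theorem ofReal_integral_norm_sq_slice (hu : ContinuousOn (FunctionSpaces.Torus.stLift u) (Ici 0 ×ˢ univ))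
    {t : ℝ} (ht : 0 ≤ t) :
    ENNReal.ofReal (∫ x, ‖u t x‖ ^ 2) = ∫⁻ x, ‖u t x‖ₑ ^ 2 := by
  have hc : Continuous (u t) := FunctionSpaces.Torus.continuous_slice_of_continuousOn_stLift hu (mem_Ici.2 ht)
  have hi : Integrable (fun x => ‖u t x‖ ^ 2) volume := (hc.norm.pow 2).integrable_unitAddTorus
  rw [ofReal_integral_eq_lintegral_ofReal hi (ae_of_all _ fun x => by positivity)]
  refine lintegral_congr fun x => ?_
  rw [← ofReal_norm, ENNReal.ofReal_pow (norm_nonneg _)]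

/-- **Interval integrals of slice energies are space–time `lintegral`s**: for a field with
space–time lift continuous on `[0, ∞) × ℝ^d` and `0 ≤ s ≤ t`,
`∫ₛᵗ ∫ ‖u‖² = (∫⁻_{(s,t)} ∫⁻ ‖u‖ₑ²).toReal`, and the right-hand `lintegral` is finite. [folklore] -/
theorem intervalIntegral_norm_sq_eq_toReal (hu : ContinuousOn (FunctionSpaces.Torus.stLift u) (Ici 0 ×ˢ univ))
    {s t : ℝ} (hs : 0 ≤ s) (hst : s ≤ t) :
    (∫⁻ τ in Ioo s t, ∫⁻ x, ‖u τ x‖ₑ ^ 2) < ⊤ ∧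
    ∫ τ in s..t, ∫ x, ‖u τ x‖ ^ 2 = (∫⁻ τ in Ioo s t, ∫⁻ x, ‖u τ x‖ₑ ^ 2).toReal := by
  have hcont : ContinuousOn (fun τ => ∫ x, ‖u τ x‖ ^ 2) (Icc s t) :=
    (FunctionSpaces.Torus.continuousOn_integral_norm_sq_of_continuousOn_stLift hu).mono
      fun τ hτ => mem_Ici.2 (hs.trans hτ.1)
  have hnn : ∀ τ, 0 ≤ ∫ x, ‖u τ x‖ ^ 2 := fun τ => integral_nonneg fun x => by positivity
  have heq : ∀ τ ∈ Ioo s t, ENNReal.ofReal (∫ x, ‖u τ x‖ ^ 2) = ∫⁻ x, ‖u τ x‖ₑ ^ 2 :=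
    fun τ hτ => ofReal_integral_norm_sq_slice hu (hs.trans hτ.1.le)
  have hlin : ∫⁻ τ in Ioo s t, ∫⁻ x, ‖u τ x‖ₑ ^ 2 =
      ∫⁻ τ in Ioo s t, ENNReal.ofReal (∫ x, ‖u τ x‖ ^ 2) :=
    setLIntegral_congr_fun measurableSet_Ioo fun τ hτ => (heq τ hτ).symm
  -- finiteness: the integrand is bounded on `[s, t]`
  obtain ⟨C, hC⟩ := isCompact_Icc.exists_bound_of_continuousOn hcont
  have hfin : (∫⁻ τ in Ioo s t, ∫⁻ x, ‖u τ x‖ₑ ^ 2) < ⊤ := by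
    rw [hlin]
    calc ∫⁻ τ in Ioo s t, ENNReal.ofReal (∫ x, ‖u τ x‖ ^ 2)
        ≤ ∫⁻ _ in Ioo s t, ENNReal.ofReal C := by
          refine setLIntegral_mono' measurableSet_Ioo fun τ hτ => ENNReal.ofReal_le_ofReal ?_
          exact (le_abs_self _).trans ((Real.norm_eq_abs _).symm.le.trans
            (hC τ (Ioo_subset_Icc_self hτ)))
      _ < ⊤ := by
          rw [setLIntegral_const]
          exact ENNReal.mul_lt_top ENNReal.ofReal_lt_top measure_Ioo_lt_top
  refine ⟨hfin, ?_⟩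
  rw [intervalIntegral.integral_of_le hst, integral_Ioc_eq_integral_Ioo,
    integral_eq_lintegral_of_nonneg_ae (ae_of_all _ fun τ => hnn τ)
      ((hcont.mono Ioo_subset_Icc_self).aestronglyMeasurable measurableSet_Ioo), hlin]

/-- Pairings of slices against the constant-in-`x` bound: for fields with continuous lifts on
`[0, ∞) × ℝ^d`, `∫ ⟪u t, v t⟫ ≤ (2η)⁻¹ ∫ ‖u t‖² + (η/2) ∫ ‖v t‖²` (Young under the integral). [folklore] -/
theorem integral_inner_slice_le_young (hu : ContinuousOn (FunctionSpaces.Torus.stLift u) (Ici 0 ×ˢ univ))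
    (hv : ContinuousOn (FunctionSpaces.Torus.stLift v) (Ici 0 ×ˢ univ)) {t : ℝ} (ht : 0 ≤ t) {η : ℝ}
    (hη : 0 < η) :
    ∫ x, ⟪u t x, v t x⟫ ≤ (2 * η)⁻¹ * (∫ x, ‖u t x‖ ^ 2) + η / 2 * ∫ x, ‖v t x‖ ^ 2 := by
  have hcu : Continuous (u t) := FunctionSpaces.Torus.continuous_slice_of_continuousOn_stLift hu (mem_Ici.2 ht)
  have hcv : Continuous (v t) := FunctionSpaces.Torus.continuous_slice_of_continuousOn_stLift hv (mem_Ici.2 ht)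
  have hi1 : Integrable (fun x => ‖u t x‖ ^ 2) volume := (hcu.norm.pow 2).integrable_unitAddTorus
  have hi2 : Integrable (fun x => ‖v t x‖ ^ 2) volume := (hcv.norm.pow 2).integrable_unitAddTorus
  rw [← integral_const_mul, ← integral_const_mul, ← integral_add (hi1.const_mul _) (hi2.const_mul _)]
  refine integral_mono (hcu.inner hcv).integrable_unitAddTorus
    ((hi1.const_mul _).add (hi2.const_mul _)) fun x => ?_
  exact inner_le_young (u t x) (v t x) hη

end SpaceTimeL2

/-! ## Reindexing a scheme -/

section Reindex

variable {ν : ℝ} {f : ℝ → UnitAddTorus d → EuclideanSpace ℝ d}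
  {u₀ : UnitAddTorus d → EuclideanSpace ℝ d} {N : ℕ → ℕ}
  {F U : ℕ → ℝ → UnitAddTorus d → EuclideanSpace ℝ d}

/-- **A subsequence of a Hopf–Galerkin scheme is a Hopf–Galerkin scheme** (for the same data):
every clause is either pointwise in `n` or a limit along `n → ∞`, preserved under composition
with a strictly increasing `φ : ℕ → ℕ`. [folklore] -/
theorem IsHopfGalerkinScheme.comp_strictMono (hS : IsHopfGalerkinScheme ν f u₀ N F U)
    {φ : ℕ → ℕ} (hφ : StrictMono φ) :
    IsHopfGalerkinScheme ν f u₀ (N ∘ φ) (F ∘ φ) (U ∘ φ) where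
  tendsto_order := hS.tendsto_order.comp hφ.tendsto_atTop
  smooth_force n := hS.smooth_force (φ n)
  tendsto_force T hT := (hS.tendsto_force T hT).comp hφ.tendsto_atTop
  continuousOn n := hS.continuousOn (φ n)
  isGalerkinMode n t ht := hS.isGalerkinMode (φ n) t ht
  isWeaklyDivFree n t ht := hS.isWeaklyDivFree (φ n) t ht
  galerkin n a ha s t hs hst := hS.galerkin (φ n) a ha s t hs hst
  energy_eq n s t hs hst := hS.energy_eq (φ n) s t hs hst
  initial_inner n a ha := hS.initial_inner (φ n) a ha
  tendsto_initial := hS.tendsto_initial.comp hφ.tendsto_atTop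

end Reindex

/-! ## Slices of a scheme -/

section SchemeSlices

variable {ν : ℝ} {f : ℝ → UnitAddTorus d → EuclideanSpace ℝ d}
  {u₀ : UnitAddTorus d → EuclideanSpace ℝ d} {N : ℕ → ℕ}
  {F U : ℕ → ℝ → UnitAddTorus d → EuclideanSpace ℝ d}

/-- The approximate forces have space–time lifts continuous on `[0, ∞) × ℝ^d` (they are smooth
everywhere). [folklore] -/
theorem IsHopfGalerkinScheme.continuousOn_force (hS : IsHopfGalerkinScheme ν f u₀ N F U) (n : ℕ) :
    ContinuousOn (FunctionSpaces.Torus.stLift (F n)) (Ici 0 ×ˢ univ) :=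
  (hS.smooth_force n).continuous.continuousOn

/-- Slices `U n t`, `t ≥ 0`, are continuous. [folklore] -/
theorem IsHopfGalerkinScheme.continuous_slice (hS : IsHopfGalerkinScheme ν f u₀ N F U) (n : ℕ)
    {t : ℝ} (ht : 0 ≤ t) : Continuous (U n t) :=
  FunctionSpaces.Torus.continuous_slice_of_continuousOn_stLift (hS.continuousOn n) (mem_Ici.2 ht)

/-- Slices `F n t`, `t ≥ 0`, are continuous. [folklore] -/
theorem IsHopfGalerkinScheme.continuous_force_slice (hS : IsHopfGalerkinScheme ν f u₀ N F U)
    (n : ℕ) {t : ℝ} (ht : 0 ≤ t) : Continuous (F n t) :=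
  FunctionSpaces.Torus.continuous_slice_of_continuousOn_stLift (hS.continuousOn_force n) (mem_Ici.2 ht)

/-- Slices `U n t`, `t ≥ 0`, are in `L²`. [folklore] -/
theorem IsHopfGalerkinScheme.memLp_slice (hS : IsHopfGalerkinScheme ν f u₀ N F U) (n : ℕ)
    {t : ℝ} (ht : 0 ≤ t) : MemLp (U n t) 2 volume :=
  (hS.continuous_slice n ht).memLp_of_hasCompactSupport (HasCompactSupport.of_compactSpace _)

/-- **Slice energies are finite Parseval sums**: `∫ ‖U n t‖² = ∑_{|k| ≤ N n} ‖Û_n(t,k)‖²`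
(`U n t` is continuous and band-limited). [folklore] -/
theorem IsHopfGalerkinScheme.integral_norm_sq_eq_sum (hS : IsHopfGalerkinScheme ν f u₀ N F U)
    (n : ℕ) {t : ℝ} (ht : 0 ≤ t) :
    ∫ x, ‖U n t x‖ ^ 2 = ∑ k ∈ FunctionSpaces.Torus.freqBall (N n),
      ‖mFourierCoeff (FunctionSpaces.EuclideanSpace.complexify ∘ U n t) k‖ ^ 2 :=
  FunctionSpaces.Torus.integral_norm_sq_eq_sum_of_band_limited (hS.continuous_slice n ht)
    fun _ hk => (hS.isGalerkinMode n t ht).mFourierCoeff_eq_zero hk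

/-- Each Fourier coefficient of a slice is controlled by the slice energy:
`‖Û_n(t,k)‖² ≤ ∫ ‖U n t‖²`. [folklore] -/
theorem IsHopfGalerkinScheme.norm_mFourierCoeff_sq_le (hS : IsHopfGalerkinScheme ν f u₀ N F U)
    (n : ℕ) {t : ℝ} (ht : 0 ≤ t) (k : d → ℤ) :
    ‖mFourierCoeff (FunctionSpaces.EuclideanSpace.complexify ∘ U n t) k‖ ^ 2 ≤ ∫ x, ‖U n t x‖ ^ 2 := by
  rw [hS.integral_norm_sq_eq_sum n ht]
  by_cases hk : k ∈ FunctionSpaces.Torus.freqBall (N n)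
  · exact Finset.single_le_sum (f := fun k =>
      ‖mFourierCoeff (FunctionSpaces.EuclideanSpace.complexify ∘ U n t) k‖ ^ 2) (fun _ _ => sq_nonneg _) hk
  · rw [(hS.isGalerkinMode n t ht).mFourierCoeff_eq_zero (FunctionSpaces.Torus.not_mem_freqBall.1 hk), norm_zero,
      zero_pow two_ne_zero]
    exact Finset.sum_nonneg fun _ _ => sq_nonneg _

/-- The Fourier coefficients of the slices are transversal: `∑ⱼ kⱼ Û_n(t,k)ⱼ = 0`
(`U n t` is smooth and divergence free). [folklore] -/
theorem IsHopfGalerkinScheme.sum_mul_mFourierCoeff_eq_zero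
    (hS : IsHopfGalerkinScheme ν f u₀ N F U) (n : ℕ) {t : ℝ} (ht : 0 ≤ t) (k : d → ℤ) :
    ∑ j, (k j : ℂ) * mFourierCoeff (FunctionSpaces.EuclideanSpace.complexify ∘ U n t) k j = 0 :=
  (hS.isGalerkinMode n t ht).isDivFree.sum_mul_mFourierCoeff_eq_zero
    (hS.isGalerkinMode n t ht).isSmooth k

/-- The Fourier coefficients of the slices are conjugate symmetric (real fields). [folklore] -/
theorem IsHopfGalerkinScheme.isConjSymm_mFourierCoeff (hS : IsHopfGalerkinScheme ν f u₀ N F U)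
    (n : ℕ) {t : ℝ} (ht : 0 ≤ t) :
    FunctionSpaces.Torus.IsConjSymm fun k => mFourierCoeff (FunctionSpaces.EuclideanSpace.complexify ∘ U n t) k :=
  FunctionSpaces.Torus.isConjSymm_mFourierCoeff (hS.continuous_slice n ht).integrable_unitAddTorus

/-- **The datum in Fourier variables**: `Û_n(0, k) = û₀(k)` for every `|k| ≤ N n` (test
`initial_inner` against the single real modes at `k` with vector the difference of the two
coefficients, which is transversal as both fields are (weakly) divergence free). [folklore] -/
theorem IsHopfGalerkinScheme.mFourierCoeff_zero_eq (hS : IsHopfGalerkinScheme ν f u₀ N F U)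
    (hu₀ : MemLp u₀ 2 volume) (hdiv : FunctionSpaces.Torus.IsWeaklyDivFree u₀) (n : ℕ) {k : d → ℤ}
    (hk : k ∈ FunctionSpaces.Torus.freqBall (N n)) :
    mFourierCoeff (FunctionSpaces.EuclideanSpace.complexify ∘ U n 0) k =
      mFourierCoeff (FunctionSpaces.EuclideanSpace.complexify ∘ u₀) k := by
  set z : EuclideanSpace ℂ d := mFourierCoeff (FunctionSpaces.EuclideanSpace.complexify ∘ U n 0) k -
    mFourierCoeff (FunctionSpaces.EuclideanSpace.complexify ∘ u₀) k with hz
  -- the single real mode at `k` with vector `z` is a Galerkin mode of order `N n`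
  have hzT : ∑ j, (k j : ℂ) * z j = 0 := by
    simp only [hz, PiLp.sub_apply, mul_sub, Finset.sum_sub_distrib]
    rw [hS.sum_mul_mFourierCoeff_eq_zero n le_rfl k,
      hdiv.sum_mul_mFourierCoeff_eq_zero hu₀ k, sub_zero]
  have hmode : IsGalerkinMode (N n) (FunctionSpaces.Torus.realTrigPoly {k} fun _ => z) := by
    refine ⟨FunctionSpaces.Torus.isSmooth_realTrigPoly _ _, FunctionSpaces.Torus.isDivFree_realTrigPoly_singleton hzT,
      fun k' hk' => FunctionSpaces.Torus.mFourierCoeff_realTrigPoly_singleton_eq_zero k _ ?_⟩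
    exact lt_of_le_of_lt (FunctionSpaces.Torus.mem_freqBall.1 hk) hk'
  have h := hS.initial_inner n _ hmode
  rw [FunctionSpaces.Torus.integral_inner_realTrigPoly_singleton (hS.continuous_slice n le_rfl).integrable_unitAddTorus,
    FunctionSpaces.Torus.integral_inner_realTrigPoly_singleton (hu₀.integrable one_le_two)] at h
  -- `Re ⟪Û - û₀, z⟫ = ‖z‖² = 0`
  have hzz : (inner ℂ z z).re = 0 := by
    have : inner ℂ z z = inner ℂ (mFourierCoeff (FunctionSpaces.EuclideanSpace.complexify ∘ U n 0) k) z -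
        inner ℂ (mFourierCoeff (FunctionSpaces.EuclideanSpace.complexify ∘ u₀) k) z := by
      rw [hz, inner_sub_left]
    rw [this, Complex.sub_re, h, sub_self]
  have hz0 : z = 0 := by
    have h2 : (inner ℂ z z).re = ‖z‖ ^ 2 := by
      rw [inner_self_eq_norm_sq_to_K]; norm_cast
    rw [h2] at hzz
    exact norm_eq_zero.1 (pow_eq_zero_iff two_ne_zero |>.1 hzz)
  exact sub_eq_zero.1 hz0

end SchemeSlices

/-! ## L1: uniform bounds -/

section Bounds

variable {ν : ℝ} {f : ℝ → UnitAddTorus d → EuclideanSpace ℝ d}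
  {u₀ : UnitAddTorus d → EuclideanSpace ℝ d} {N : ℕ → ℕ}
  {F U : ℕ → ℝ → UnitAddTorus d → EuclideanSpace ℝ d}

/-- **The approximate forces are bounded in `L²((0,T) × T^d)` uniformly in `n`**: since
`F n → f` in `L²ₜL²ₓ` and `f ∈ L²ₜL²ₓ` (`‖F n‖² ≤ 2‖F n - f‖² + 2‖f‖²`; the finitely many `n`
before the convergence kicks in are bounded individually, `F n` being continuous). [folklore] -/
theorem IsHopfGalerkinScheme.exists_force_bound (hS : IsHopfGalerkinScheme ν f u₀ N F U)
    (hfm : AEStronglyMeasurable (FunctionSpaces.Torus.stLift f) (volume.restrict (Ioi 0 ×ˢ univ)))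
    (hf₂ : ∀ T, 0 < T → ∫⁻ t in Ioo 0 T, ∫⁻ x, ‖f t x‖ₑ ^ 2 < ⊤) {T : ℝ} (hT : 0 < T) :
    ∃ A : ℝ≥0∞, A ≠ ⊤ ∧ ∀ n, ∫⁻ t in Ioo 0 T, ∫⁻ x, ‖F n t x‖ₑ ^ 2 ≤ A := by
  -- each `F n` has finite space–time norm on the strip
  have hfinn : ∀ n, ∫⁻ t in Ioo 0 T, ∫⁻ x, ‖F n t x‖ₑ ^ 2 < ⊤ := fun n =>
    (intervalIntegral_norm_sq_eq_toReal (hS.continuousOn_force n) le_rfl hT.le).1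
  -- splitting `‖F n‖² ≤ 2‖F n - f‖² + 2‖f‖²` under the double integral
  have hF := FunctionSpaces.Torus.aestronglyMeasurable_uncurry_prod_of_stLift hfm T
  have hsplit : ∀ n, ∫⁻ t in Ioo 0 T, ∫⁻ x, ‖F n t x‖ₑ ^ 2 ≤
      2 * (∫⁻ t in Ioo 0 T, ∫⁻ x, ‖F n t x - f t x‖ₑ ^ 2) + 2 * ∫⁻ t in Ioo 0 T, ∫⁻ x, ‖f t x‖ₑ ^ 2 := by
    intro n
    have hFn : AEStronglyMeasurable (uncurry (F n)) ((volume.restrict (Ioo 0 T)).prod volume) :=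
      (FunctionSpaces.Torus.continuous_uncurry_of_continuous_stLift (hS.smooth_force n).continuous).aestronglyMeasurable
    have hdiff : AEStronglyMeasurable (fun p : ℝ × UnitAddTorus d => uncurry (F n) p - uncurry f p)
        ((volume.restrict (Ioo 0 T)).prod volume) := hFn.sub hF
    -- inner splitting for a.e. `t`
    have hslice : ∀ᵐ t ∂(volume.restrict (Ioo 0 T)),
        AEStronglyMeasurable (fun x => F n t x - f t x) volume := hdiff.prodMk_left
    have hinner : ∀ᵐ t ∂(volume.restrict (Ioo 0 T)), ∫⁻ x, ‖F n t x‖ₑ ^ 2 ≤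
        2 * (∫⁻ x, ‖F n t x - f t x‖ₑ ^ 2) + 2 * ∫⁻ x, ‖f t x‖ₑ ^ 2 := by
      filter_upwards [hslice] with t ht
      calc ∫⁻ x, ‖F n t x‖ₑ ^ 2 ≤ ∫⁻ x, (2 * ‖F n t x - f t x‖ₑ ^ 2 + 2 * ‖f t x‖ₑ ^ 2) :=
            lintegral_mono fun x => enorm_sq_le_two_mul_add _ _
        _ = 2 * (∫⁻ x, ‖F n t x - f t x‖ₑ ^ 2) + 2 * ∫⁻ x, ‖f t x‖ₑ ^ 2 := by
            rw [lintegral_add_left' ((ht.enorm.pow_const 2).const_mul _),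
              lintegral_const_mul' _ _ ENNReal.ofNat_ne_top,
              lintegral_const_mul' _ _ ENNReal.ofNat_ne_top]
    have houter : AEMeasurable (fun t => 2 * ∫⁻ x, ‖F n t x - f t x‖ₑ ^ 2)
        (volume.restrict (Ioo 0 T)) :=
      ((hdiff.aemeasurable.enorm.pow_const 2).lintegral_prod_right').const_mul _
    calc ∫⁻ t in Ioo 0 T, ∫⁻ x, ‖F n t x‖ₑ ^ 2
        ≤ ∫⁻ t in Ioo 0 T, (2 * (∫⁻ x, ‖F n t x - f t x‖ₑ ^ 2) + 2 * ∫⁻ x, ‖f t x‖ₑ ^ 2) :=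
          lintegral_mono_ae hinner
      _ = 2 * (∫⁻ t in Ioo 0 T, ∫⁻ x, ‖F n t x - f t x‖ₑ ^ 2) +
          2 * ∫⁻ t in Ioo 0 T, ∫⁻ x, ‖f t x‖ₑ ^ 2 := by
          rw [lintegral_add_left' houter, lintegral_const_mul' _ _ ENNReal.ofNat_ne_top,
            lintegral_const_mul' _ _ ENNReal.ofNat_ne_top]
  -- eventually the error is at most `1`
  obtain ⟨n₀, hn₀⟩ : ∃ n₀, ∀ n, n₀ ≤ n → ∫⁻ t in Ioo 0 T, ∫⁻ x, ‖F n t x - f t x‖ₑ ^ 2 ≤ 1 := by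
    have h := hS.tendsto_force T hT
    have h1 : ∀ᶠ n in atTop, ∫⁻ t in Ioo 0 T, ∫⁻ x, ‖F n t x - f t x‖ₑ ^ 2 ≤ 1 :=
      h.eventually (ge_mem_nhds zero_lt_one)
    exact eventually_atTop.1 h1
  refine ⟨(∑ n ∈ Finset.range n₀, ∫⁻ t in Ioo 0 T, ∫⁻ x, ‖F n t x‖ₑ ^ 2) +
    (2 * 1 + 2 * ∫⁻ t in Ioo 0 T, ∫⁻ x, ‖f t x‖ₑ ^ 2), ?_, fun n => ?_⟩
  · refine ENNReal.add_ne_top.2 ⟨?_, ENNReal.add_ne_top.2 ⟨by norm_num, ?_⟩⟩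
    · exact (ENNReal.sum_lt_top.2 fun n _ => hfinn n).ne
    · exact ENNReal.mul_ne_top ENNReal.ofNat_ne_top (hf₂ T hT).ne
  · by_cases hn : n < n₀
    · exact le_add_right (Finset.single_le_sum (f := fun n => ∫⁻ t in Ioo 0 T, ∫⁻ x, ‖F n t x‖ₑ ^ 2)
        (fun _ _ => bot_le) (Finset.mem_range.2 hn))
    · refine le_add_left ((hsplit n).trans ?_)
      gcongr
      exact hn₀ n (not_lt.1 hn)

/-- The force integral of the energy identity is controlled by Young's inequality:
`∫₀ᵗ ∫ ⟪F n, U n⟫ ≤ (2η)⁻¹ A + (η/2) t · Y` whenever `∫⁻⁻ ‖F n‖ₑ² ≤ A` on `(0, T)`, `t ≤ T`,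
and `∫ ‖U n τ‖² ≤ Y` on `[0, t]`. [folklore] -/
theorem IsHopfGalerkinScheme.force_work_le (hS : IsHopfGalerkinScheme ν f u₀ N F U) (n : ℕ)
    {T t : ℝ} (ht : 0 ≤ t) (htT : t ≤ T) {A : ℝ≥0∞} (hA : A ≠ ⊤)
    (hFA : ∫⁻ τ in Ioo 0 T, ∫⁻ x, ‖F n τ x‖ₑ ^ 2 ≤ A) {Y : ℝ}
    (hY : ∀ τ ∈ Icc 0 t, ∫ x, ‖U n τ x‖ ^ 2 ≤ Y) {η : ℝ} (hη : 0 < η) :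
    ∫ τ in (0 : ℝ)..t, ∫ x, ⟪F n τ x, U n τ x⟫ ≤ (2 * η)⁻¹ * A.toReal + η / 2 * (t * Y) := by
  have hFc := hS.continuousOn_force n
  have hUc := hS.continuousOn n
  -- continuity of the three slice functionals on `[0, t]`
  have hPc : ContinuousOn (fun τ => ∫ x, ⟪F n τ x, U n τ x⟫) (Icc 0 t) :=
    (FunctionSpaces.Torus.continuousOn_integral_inner_of_continuousOn_stLift hFc hUc).mono fun τ hτ => mem_Ici.2 hτ.1
  have hφc : ContinuousOn (fun τ => ∫ x, ‖F n τ x‖ ^ 2) (Icc 0 t) :=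
    (FunctionSpaces.Torus.continuousOn_integral_norm_sq_of_continuousOn_stLift hFc).mono fun τ hτ => mem_Ici.2 hτ.1
  have hyc : ContinuousOn (fun τ => ∫ x, ‖U n τ x‖ ^ 2) (Icc 0 t) :=
    (FunctionSpaces.Torus.continuousOn_integral_norm_sq_of_continuousOn_stLift hUc).mono fun τ hτ => mem_Ici.2 hτ.1
  have hI : ∀ {g : ℝ → ℝ}, ContinuousOn g (Icc 0 t) → IntervalIntegrable g volume 0 t :=
    fun hg => (hg.mono (by rw [uIcc_of_le ht])).intervalIntegrable
  -- pointwise Young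
  have hpt : ∀ τ ∈ Icc 0 t, ∫ x, ⟪F n τ x, U n τ x⟫ ≤
      (2 * η)⁻¹ * (∫ x, ‖F n τ x‖ ^ 2) + η / 2 * ∫ x, ‖U n τ x‖ ^ 2 :=
    fun τ hτ => integral_inner_slice_le_young hFc hUc hτ.1 hη
  have hgc : ContinuousOn (fun τ => (2 * η)⁻¹ * (∫ x, ‖F n τ x‖ ^ 2) + η / 2 * ∫ x, ‖U n τ x‖ ^ 2)
      (Icc 0 t) := (continuousOn_const.fun_mul hφc).fun_add (continuousOn_const.fun_mul hyc)
  have h1 : ∫ τ in (0 : ℝ)..t, ∫ x, ⟪F n τ x, U n τ x⟫ ≤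
      ∫ τ in (0 : ℝ)..t, ((2 * η)⁻¹ * (∫ x, ‖F n τ x‖ ^ 2) + η / 2 * ∫ x, ‖U n τ x‖ ^ 2) :=
    intervalIntegral.integral_mono_on ht (hI hPc) (hI hgc) hpt
  have h2 : ∫ τ in (0 : ℝ)..t, ((2 * η)⁻¹ * (∫ x, ‖F n τ x‖ ^ 2) + η / 2 * ∫ x, ‖U n τ x‖ ^ 2) =
      (2 * η)⁻¹ * (∫ τ in (0 : ℝ)..t, ∫ x, ‖F n τ x‖ ^ 2) +
        η / 2 * ∫ τ in (0 : ℝ)..t, ∫ x, ‖U n τ x‖ ^ 2 := by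
    rw [intervalIntegral.integral_add ((hI hφc).const_mul _) ((hI hyc).const_mul _),
      intervalIntegral.integral_const_mul, intervalIntegral.integral_const_mul]
  -- the force part
  have h3 : ∫ τ in (0 : ℝ)..t, ∫ x, ‖F n τ x‖ ^ 2 ≤ A.toReal := by
    obtain ⟨hfin, heq⟩ := intervalIntegral_norm_sq_eq_toReal hFc le_rfl ht
    rw [heq]
    refine ENNReal.toReal_mono hA ((lintegral_mono_set (Ioo_subset_Ioo_right htT)).trans hFA)
  -- the kinetic part
  have h4 : ∫ τ in (0 : ℝ)..t, ∫ x, ‖U n τ x‖ ^ 2 ≤ t * Y := by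
    have h := intervalIntegral.integral_mono_on ht (hI hyc) (hI continuousOn_const) hY
    rwa [intervalIntegral.integral_const, smul_eq_mul, sub_zero] at h
  have hη' : 0 ≤ (2 * η)⁻¹ := by positivity
  calc ∫ τ in (0 : ℝ)..t, ∫ x, ⟪F n τ x, U n τ x⟫
      ≤ (2 * η)⁻¹ * (∫ τ in (0 : ℝ)..t, ∫ x, ‖F n τ x‖ ^ 2) +
        η / 2 * ∫ τ in (0 : ℝ)..t, ∫ x, ‖U n τ x‖ ^ 2 := h1.trans_eq h2
    _ ≤ (2 * η)⁻¹ * A.toReal + η / 2 * (t * Y) := by gcongr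

/-- **L1: uniform energy bound** (Robinson–Rodrigo–Sadowski 2016, (4.8)–(4.9); Constantin–Foias
1988, (8.10)–(8.12)). For a Hopf–Galerkin scheme with `ν ≥ 0`, on every `[0, T]`:
`∫ ‖U n t‖² ≤ 2 ∫ ‖U n 0‖² + 4 T A` whenever `∫⁻_{(0,T)} ∫⁻ ‖F n‖ₑ² ≤ A` (energy identity from
`0`, Young's inequality with `η = 1/(2T)`, and the maximum of the continuous function
`t ↦ ‖U n t‖₂²` on `[0, T]`). [cite: RobinsonRodrigoSadowski2016, Thm. 4.4 Step 3 (4.8)] -/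
theorem IsHopfGalerkinScheme.integral_norm_sq_le (hS : IsHopfGalerkinScheme ν f u₀ N F U)
    (hν : 0 ≤ ν) {T : ℝ} (hT : 0 < T) {A : ℝ≥0∞} (hA : A ≠ ⊤) (n : ℕ)
    (hFA : ∫⁻ τ in Ioo 0 T, ∫⁻ x, ‖F n τ x‖ₑ ^ 2 ≤ A) {t : ℝ} (ht : t ∈ Icc 0 T) :
    ∫ x, ‖U n t x‖ ^ 2 ≤ 2 * (∫ x, ‖U n 0 x‖ ^ 2) + 4 * T * A.toReal := by
  -- the maximum of the slice energy on `[0, T]`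
  have hyc : ContinuousOn (fun τ => ∫ x, ‖U n τ x‖ ^ 2) (Icc 0 T) :=
    (FunctionSpaces.Torus.continuousOn_integral_norm_sq_of_continuousOn_stLift (hS.continuousOn n)).mono
      fun τ hτ => mem_Ici.2 hτ.1
  obtain ⟨t₁, ht₁, hmax⟩ := isCompact_Icc.exists_isMaxOn (nonempty_Icc.2 hT.le) hyc
  set Y := ∫ x, ‖U n t₁ x‖ ^ 2 with hYdef
  have hY : ∀ τ ∈ Icc 0 T, ∫ x, ‖U n τ x‖ ^ 2 ≤ Y := fun τ hτ => hmax hτ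
  have hY0 : 0 ≤ Y := integral_nonneg fun x => by positivity
  -- energy identity from `0` to `t₁`, in terms of `∫ ‖·‖²`
  have hE := hS.energy_eq n 0 t₁ le_rfl ht₁.1
  have hW := hS.force_work_le n ht₁.1 ht₁.2 hA hFA (fun τ hτ => hY τ ⟨hτ.1, hτ.2.trans ht₁.2⟩)
    (η := (2 * T)⁻¹) (by positivity)
  have hD : 0 ≤ ν * (∫⁻ τ in Ioo 0 t₁, FunctionSpaces.Torus.eGradNormSq (U n τ)).toReal :=
    mul_nonneg hν ENNReal.toReal_nonneg
  simp only [FunctionSpaces.Torus.kineticEnergy] at hE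
  have hη : (2 * (2 * T)⁻¹)⁻¹ = T := by field_simp
  rw [hη] at hW
  have hkey : (2 * T)⁻¹ / 2 * (t₁ * Y) ≤ Y / 4 := by
    have : (2 * T)⁻¹ / 2 * (t₁ * Y) = (t₁ / T) * (Y / 4) := by field_simp; ring
    rw [this]
    calc t₁ / T * (Y / 4) ≤ 1 * (Y / 4) := by
          gcongr
          exact (div_le_one hT).2 ht₁.2
      _ = Y / 4 := one_mul _
  -- `Y ≤ 2 y(0) + 4 T A`
  have hYle : Y ≤ 2 * (∫ x, ‖U n 0 x‖ ^ 2) + 4 * T * A.toReal := by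
    have : 2⁻¹ * Y ≤ 2⁻¹ * (∫ x, ‖U n 0 x‖ ^ 2) + T * A.toReal + Y / 4 := by linarith
    linarith
  exact (hY t ht).trans hYle

/-- **L1: uniform dissipation bound** (Robinson–Rodrigo–Sadowski 2016, (4.9); Constantin–Foias
1988, (8.12)): `ν ∫₀ᵀ ‖∇U n‖₂² ≤ ∫ ‖U n 0‖² + 2 T A` whenever `∫⁻_{(0,T)} ∫⁻ ‖F n‖ₑ² ≤ A`
(`ν ≥ 0`). [cite: RobinsonRodrigoSadowski2016, Thm. 4.4 Step 3 (4.9)] -/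
theorem IsHopfGalerkinScheme.dissipation_le (hS : IsHopfGalerkinScheme ν f u₀ N F U)
    (hν : 0 ≤ ν) {T : ℝ} (hT : 0 < T) {A : ℝ≥0∞} (hA : A ≠ ⊤) (n : ℕ)
    (hFA : ∫⁻ τ in Ioo 0 T, ∫⁻ x, ‖F n τ x‖ₑ ^ 2 ≤ A) :
    ν * (∫⁻ τ in Ioo 0 T, FunctionSpaces.Torus.eGradNormSq (U n τ)).toReal ≤
      (∫ x, ‖U n 0 x‖ ^ 2) + 2 * T * A.toReal := by
  set Y := 2 * (∫ x, ‖U n 0 x‖ ^ 2) + 4 * T * A.toReal with hYdef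
  have hY : ∀ τ ∈ Icc 0 T, ∫ x, ‖U n τ x‖ ^ 2 ≤ Y := fun τ hτ =>
    hS.integral_norm_sq_le hν hT hA n hFA hτ
  have hE := hS.energy_eq n 0 T le_rfl hT.le
  have hW := hS.force_work_le n hT.le le_rfl hA hFA hY (η := (2 * T)⁻¹) (by positivity)
  simp only [FunctionSpaces.Torus.kineticEnergy] at hE
  have hη : (2 * (2 * T)⁻¹)⁻¹ = T := by field_simp
  have hkey : (2 * T)⁻¹ / 2 * (T * Y) = Y / 4 := by field_simp; ring
  rw [hη, hkey] at hW
  have hpos : 0 ≤ 2⁻¹ * ∫ x, ‖U n T x‖ ^ 2 := by positivity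
  have : ν * (∫⁻ τ in Ioo 0 T, FunctionSpaces.Torus.eGradNormSq (U n τ)).toReal ≤
      2⁻¹ * (∫ x, ‖U n 0 x‖ ^ 2) + T * A.toReal + Y / 4 := by linarith
  rw [hYdef] at this
  linarith

/-- The initial energies are bounded by the energy of the datum: `∫ ‖U n 0‖² ≤ ∫ ‖u₀‖²`
(`⟪U n 0, U n 0⟫ = ⟪u₀, U n 0⟫ ≤ ½‖u₀‖² + ½‖U n 0‖²`, from `initial_inner` with the Galerkin
mode `U n 0`; Robinson–Rodrigo–Sadowski 2016, (4.4): `‖P_n u₀‖ ≤ ‖u₀‖`). [cite: RobinsonRodrigoSadowski2016, §4.1 (4.4)] -/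
theorem IsHopfGalerkinScheme.integral_norm_sq_zero_le (hS : IsHopfGalerkinScheme ν f u₀ N F U)
    (hu₀ : MemLp u₀ 2 volume) (n : ℕ) :
    ∫ x, ‖U n 0 x‖ ^ 2 ≤ ∫ x, ‖u₀ x‖ ^ 2 := by
  have h := hS.initial_inner n (U n 0) (hS.isGalerkinMode n 0 le_rfl)
  have hc : Continuous (U n 0) := hS.continuous_slice n le_rfl
  have hself : ∫ x, ⟪U n 0 x, U n 0 x⟫ = ∫ x, ‖U n 0 x‖ ^ 2 :=
    integral_congr_ae (ae_of_all _ fun x => real_inner_self_eq_norm_sq _)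
  have hi1 : Integrable (fun x => ‖u₀ x‖ ^ 2) volume := hu₀.integrable_norm_pow two_ne_zero
  have hi2 : Integrable (fun x => ‖U n 0 x‖ ^ 2) volume := (hc.norm.pow 2).integrable_unitAddTorus
  have hyoung : ∫ x, ⟪u₀ x, U n 0 x⟫ ≤ 2⁻¹ * (∫ x, ‖u₀ x‖ ^ 2) + 2⁻¹ * ∫ x, ‖U n 0 x‖ ^ 2 := by
    rw [← integral_const_mul, ← integral_const_mul, ← integral_add (hi1.const_mul _) (hi2.const_mul _)]
    refine integral_mono (FunctionSpaces.Torus.integrable_inner_of_continuous (hu₀.integrable one_le_two) hc)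
      ((hi1.const_mul _).add (hi2.const_mul _)) fun x => ?_
    have := inner_le_young (u₀ x) (U n 0 x) one_pos
    simp only [mul_one, one_div] at this
    exact this
  rw [hself] at h
  rw [← h] at hyoung
  linarith

end Bounds

/-! ## L2: the Galerkin equations tested against single modes; modulus of continuity -/

section Modulus

variable {ν : ℝ} {f : ℝ → UnitAddTorus d → EuclideanSpace ℝ d}
  {u₀ : UnitAddTorus d → EuclideanSpace ℝ d} {N : ℕ → ℕ}
  {F U : ℕ → ℝ → UnitAddTorus d → EuclideanSpace ℝ d}

omit [DecidableEq d] in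
/-- The single real mode at a frequency `k` of the ball `|k| ≤ N` with a transversal vector `z`
(`k · z = 0`) is a Galerkin mode of order `N`. [folklore] -/
theorem isGalerkinMode_realTrigPoly_singleton [DecidableEq d] {M : ℕ} {k : d → ℤ}
    (hk : k ∈ FunctionSpaces.Torus.freqBall M) {z : EuclideanSpace ℂ d} (hz : ∑ j, (k j : ℂ) * z j = 0) :
    IsGalerkinMode M (FunctionSpaces.Torus.realTrigPoly {k} fun _ => z) := by
  refine ⟨FunctionSpaces.Torus.isSmooth_realTrigPoly _ _, FunctionSpaces.Torus.isDivFree_realTrigPoly_singleton hz,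
    fun k' hk' => FunctionSpaces.Torus.mFourierCoeff_realTrigPoly_singleton_eq_zero k _ ?_⟩
  exact lt_of_le_of_lt (FunctionSpaces.Torus.mem_freqBall.1 hk) hk'

/-- **The Galerkin equations in Fourier variables, tested against a single mode**: for
`k` in the ball of order `N n`, `z ∈ ℂ^d` transversal to `k`, and `0 ≤ s ≤ t`,
`Re ⟪Û_n(t,k) - Û_n(s,k), z⟫ = ∫ₛᵗ ∫ (⟪U n, (U n·∇)a⟫ + ν ⟪U n, Δa⟫ + ⟪F n, a⟫)` with
`a = Re (e_k • z)` (the clause `galerkin` with the Galerkin mode `a`; Robinson–Rodrigo–Sadowski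
2016, (4.5)/(4.12) in Fourier variables; Hopf 1951, §4). [cite: RobinsonRodrigoSadowski2016, Thm. 4.4 Step 3 (4.12)] -/
theorem IsHopfGalerkinScheme.re_inner_mFourierCoeff_sub_eq (hS : IsHopfGalerkinScheme ν f u₀ N F U)
    (n : ℕ) {k : d → ℤ} (hk : k ∈ FunctionSpaces.Torus.freqBall (N n)) {z : EuclideanSpace ℂ d}
    (hz : ∑ j, (k j : ℂ) * z j = 0) {s t : ℝ} (hs : 0 ≤ s) (hst : s ≤ t) :
    (inner ℂ (mFourierCoeff (FunctionSpaces.EuclideanSpace.complexify ∘ U n t) k -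
        mFourierCoeff (FunctionSpaces.EuclideanSpace.complexify ∘ U n s) k) z).re =
      ∫ τ in s..t, ∫ x, (⟪U n τ x, FunctionSpaces.Torus.convect (U n τ) (FunctionSpaces.Torus.realTrigPoly {k} fun _ => z) x⟫ +
        ν * ⟪U n τ x, FunctionSpaces.Torus.laplacian (FunctionSpaces.Torus.realTrigPoly {k} fun _ => z) x⟫ +
        ⟪F n τ x, FunctionSpaces.Torus.realTrigPoly {k} (fun _ => z) x⟫) := by
  have h := hS.galerkin n _ (isGalerkinMode_realTrigPoly_singleton hk hz) s t hs hst
  rw [FunctionSpaces.Torus.integral_inner_realTrigPoly_singleton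
      (hS.continuous_slice n (hs.trans hst)).integrable_unitAddTorus,
    FunctionSpaces.Torus.integral_inner_realTrigPoly_singleton (hS.continuous_slice n hs).integrable_unitAddTorus]
    at h
  rw [inner_sub_left, Complex.sub_re]
  exact h

omit [DecidableEq d] in
/-- Pointwise bound for the integrand of the tested Galerkin equations against the single mode
`a = Re (e_k • z)`: with `C_k = #d · 2π |k|`,
`|⟪U, (U·∇)a⟫ + ν⟪U, Δa⟫ + ⟪F, a⟫| ≤ (C_k ‖z‖ + 2νπ²|k|²) ‖U‖² + (2νπ²|k|² + (2η)⁻¹) ‖z‖² + (η/2) ‖F‖²`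
(`‖a‖ ≤ ‖z‖`, `‖(U·∇)a‖ ≤ C_k ‖z‖ ‖U‖`, `Δa = -4π²|k|² a`, and Young's inequality; `ν ≥ 0`). [folklore] -/
theorem abs_galerkin_integrand_singleton_le [DecidableEq d] (hν : 0 ≤ ν)
    (u F₀ : UnitAddTorus d → EuclideanSpace ℝ d) (k : d → ℤ) (z : EuclideanSpace ℂ d) {η : ℝ}
    (hη : 0 < η) (x : UnitAddTorus d) :
    |⟪u x, FunctionSpaces.Torus.convect u (FunctionSpaces.Torus.realTrigPoly {k} fun _ => z) x⟫ +
        ν * ⟪u x, FunctionSpaces.Torus.laplacian (FunctionSpaces.Torus.realTrigPoly {k} fun _ => z) x⟫ +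
        ⟪F₀ x, FunctionSpaces.Torus.realTrigPoly {k} (fun _ => z) x⟫| ≤
      (Fintype.card d * (2 * Real.pi * Real.sqrt (FunctionSpaces.Torus.freqNormSq k) * ‖z‖) +
          ν * (2 * Real.pi ^ 2 * FunctionSpaces.Torus.freqNormSq k)) * ‖u x‖ ^ 2 +
        (ν * (2 * Real.pi ^ 2 * FunctionSpaces.Torus.freqNormSq k) + (2 * η)⁻¹) * ‖z‖ ^ 2 +
        η / 2 * ‖F₀ x‖ ^ 2 := by
  set a := FunctionSpaces.Torus.realTrigPoly {k} (fun _ => z) with ha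
  have hax : ‖a x‖ ≤ ‖z‖ := FunctionSpaces.Torus.norm_realTrigPoly_singleton_le k (fun _ => z) x
  have hfk : 0 ≤ FunctionSpaces.Torus.freqNormSq k := FunctionSpaces.Torus.freqNormSq_nonneg k
  -- the three terms
  have h1 : |⟪u x, FunctionSpaces.Torus.convect u a x⟫| ≤
      Fintype.card d * (2 * Real.pi * Real.sqrt (FunctionSpaces.Torus.freqNormSq k) * ‖z‖) * ‖u x‖ ^ 2 := by
    refine (abs_real_inner_le_norm _ _).trans ?_
    have hc := FunctionSpaces.Torus.norm_convect_realTrigPoly_singleton_le u k (fun _ => z) x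
    calc ‖u x‖ * ‖FunctionSpaces.Torus.convect u a x‖
        ≤ ‖u x‖ * (‖u x‖ * (Fintype.card d * (2 * Real.pi * Real.sqrt (FunctionSpaces.Torus.freqNormSq k) * ‖z‖))) :=
          mul_le_mul_of_nonneg_left hc (norm_nonneg _)
      _ = Fintype.card d * (2 * Real.pi * Real.sqrt (FunctionSpaces.Torus.freqNormSq k) * ‖z‖) * ‖u x‖ ^ 2 := by
          ring
  have h2 : |ν * ⟪u x, FunctionSpaces.Torus.laplacian a x⟫| ≤
      ν * (2 * Real.pi ^ 2 * FunctionSpaces.Torus.freqNormSq k) * ‖u x‖ ^ 2 +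
        ν * (2 * Real.pi ^ 2 * FunctionSpaces.Torus.freqNormSq k) * ‖z‖ ^ 2 := by
    rw [ha, FunctionSpaces.Torus.laplacian_realTrigPoly_singleton, inner_smul_right, ← ha, abs_mul, abs_mul,
      abs_of_nonneg hν, abs_neg, abs_of_nonneg (by positivity : (0 : ℝ) ≤ 4 * Real.pi ^ 2 * _)]
    have hin : |⟪u x, a x⟫| ≤ ‖u x‖ * ‖z‖ :=
      (abs_real_inner_le_norm _ _).trans (mul_le_mul_of_nonneg_left hax (norm_nonneg _))
    have hy : ‖u x‖ * ‖z‖ ≤ (‖u x‖ ^ 2 + ‖z‖ ^ 2) / 2 := by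
      nlinarith [sq_nonneg (‖u x‖ - ‖z‖)]
    calc ν * (4 * Real.pi ^ 2 * FunctionSpaces.Torus.freqNormSq k * |⟪u x, a x⟫|)
        ≤ ν * (4 * Real.pi ^ 2 * FunctionSpaces.Torus.freqNormSq k * ((‖u x‖ ^ 2 + ‖z‖ ^ 2) / 2)) := by
          gcongr
          exact hin.trans hy
      _ = _ := by ring
  have h3 : |⟪F₀ x, a x⟫| ≤ (2 * η)⁻¹ * ‖z‖ ^ 2 + η / 2 * ‖F₀ x‖ ^ 2 := by
    refine (abs_real_inner_le_norm _ _).trans ?_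
    have hin : ‖F₀ x‖ * ‖a x‖ ≤ ‖F₀ x‖ * ‖z‖ := mul_le_mul_of_nonneg_left hax (norm_nonneg _)
    have hy : ‖F₀ x‖ * ‖z‖ ≤ (2 * η)⁻¹ * ‖z‖ ^ 2 + η / 2 * ‖F₀ x‖ ^ 2 := by
      have hkey : ‖F₀ x‖ * ‖z‖ = (Real.sqrt η * ‖F₀ x‖) * (‖z‖ / Real.sqrt η) := by
        have hs : Real.sqrt η ≠ 0 := (Real.sqrt_pos.2 hη).ne'
        field_simp
      rw [hkey]
      have hsq : Real.sqrt η ^ 2 = η := Real.sq_sqrt hη.le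
      nlinarith [sq_nonneg (Real.sqrt η * ‖F₀ x‖ - ‖z‖ / Real.sqrt η), hsq,
        show (‖z‖ / Real.sqrt η) ^ 2 = ‖z‖ ^ 2 / η by rw [div_pow, hsq],
        show (2 * η)⁻¹ * ‖z‖ ^ 2 = (‖z‖ ^ 2 / η) / 2 by field_simp]
    exact hin.trans hy
  calc |⟪u x, FunctionSpaces.Torus.convect u a x⟫ + ν * ⟪u x, FunctionSpaces.Torus.laplacian a x⟫ + ⟪F₀ x, a x⟫|
      ≤ |⟪u x, FunctionSpaces.Torus.convect u a x⟫| + |ν * ⟪u x, FunctionSpaces.Torus.laplacian a x⟫| + |⟪F₀ x, a x⟫| :=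
        (abs_add_le _ _).trans (add_le_add (abs_add_le _ _) le_rfl)
    _ ≤ _ := by linarith [h1, h2, h3]

/-- Slice bound for the tested Galerkin integrand against a single mode: for `t ≥ 0`,
`|∫ (⟪U, (U·∇)a⟫ + ν⟪U, Δa⟫ + ⟪F, a⟫)| ≤ α ∫ ‖U n t‖² + β ‖z‖² + (η/2) ∫ ‖F n t‖²` with the
constants of `abs_galerkin_integrand_singleton_le` (integrate the pointwise bound; the torus has
volume one). [folklore] -/
theorem IsHopfGalerkinScheme.abs_integral_galerkin_singleton_le
    (hS : IsHopfGalerkinScheme ν f u₀ N F U) (hν : 0 ≤ ν) (n : ℕ) (k : d → ℤ)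
    (z : EuclideanSpace ℂ d) {η : ℝ} (hη : 0 < η) {t : ℝ} (ht : 0 ≤ t) :
    |∫ x, (⟪U n t x, FunctionSpaces.Torus.convect (U n t) (FunctionSpaces.Torus.realTrigPoly {k} fun _ => z) x⟫ +
        ν * ⟪U n t x, FunctionSpaces.Torus.laplacian (FunctionSpaces.Torus.realTrigPoly {k} fun _ => z) x⟫ +
        ⟪F n t x, FunctionSpaces.Torus.realTrigPoly {k} (fun _ => z) x⟫)| ≤
      (Fintype.card d * (2 * Real.pi * Real.sqrt (FunctionSpaces.Torus.freqNormSq k) * ‖z‖) +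
          ν * (2 * Real.pi ^ 2 * FunctionSpaces.Torus.freqNormSq k)) * (∫ x, ‖U n t x‖ ^ 2) +
        (ν * (2 * Real.pi ^ 2 * FunctionSpaces.Torus.freqNormSq k) + (2 * η)⁻¹) * ‖z‖ ^ 2 +
        η / 2 * ∫ x, ‖F n t x‖ ^ 2 := by
  set α := Fintype.card d * (2 * Real.pi * Real.sqrt (FunctionSpaces.Torus.freqNormSq k) * ‖z‖) +
    ν * (2 * Real.pi ^ 2 * FunctionSpaces.Torus.freqNormSq k) with hα
  set β := (ν * (2 * Real.pi ^ 2 * FunctionSpaces.Torus.freqNormSq k) + (2 * η)⁻¹) * ‖z‖ ^ 2 with hβ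
  have hcu : Continuous (U n t) := hS.continuous_slice n ht
  have hcF : Continuous (F n t) := hS.continuous_force_slice n ht
  have hi1 : Integrable (fun x => ‖U n t x‖ ^ 2) volume := (hcu.norm.pow 2).integrable_unitAddTorus
  have hi2 : Integrable (fun x => ‖F n t x‖ ^ 2) volume := (hcF.norm.pow 2).integrable_unitAddTorus
  have hg : Integrable (fun x => α * ‖U n t x‖ ^ 2 + β + η / 2 * ‖F n t x‖ ^ 2) volume :=
    ((hi1.const_mul α).add (integrable_const β)).add (hi2.const_mul _)
  have hpt : ∀ᵐ x ∂volume, ‖⟪U n t x, FunctionSpaces.Torus.convect (U n t) (FunctionSpaces.Torus.realTrigPoly {k} fun _ => z) x⟫ +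
      ν * ⟪U n t x, FunctionSpaces.Torus.laplacian (FunctionSpaces.Torus.realTrigPoly {k} fun _ => z) x⟫ +
      ⟪F n t x, FunctionSpaces.Torus.realTrigPoly {k} (fun _ => z) x⟫‖ ≤
      α * ‖U n t x‖ ^ 2 + β + η / 2 * ‖F n t x‖ ^ 2 :=
    ae_of_all _ fun x => by
      rw [Real.norm_eq_abs]
      exact abs_galerkin_integrand_singleton_le hν (U n t) (F n t) k z hη x
  have h := norm_integral_le_of_norm_le hg hpt
  rw [Real.norm_eq_abs] at h
  refine h.trans (le_of_eq ?_)
  have hi12 : Integrable (fun x => α * ‖U n t x‖ ^ 2 + β) volume :=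
    (hi1.const_mul α).add (integrable_const β)
  have hi3 : Integrable (fun x => η / 2 * ‖F n t x‖ ^ 2) volume := hi2.const_mul _
  rw [integral_add hi12 hi3, integral_add (hi1.const_mul α) (integrable_const β),
    integral_const_mul α, integral_const_mul (η / 2), integral_const]
  simp

/-- **L2, quantitative**: for `k` in the ball of order `N n`, `z` transversal to `k`,
`0 ≤ s ≤ t ≤ T`, a force bound `∫⁻_{(0,T)} ∫⁻ ‖F n‖ₑ² ≤ A` and a kinetic bound `∫ ‖U n τ‖² ≤ Y` on
`[0, T]`: for every `η > 0`,
`|Re ⟪Û_n(t,k) - Û_n(s,k), z⟫| ≤ (t - s)(α Y + β ‖z‖²) + (η/2) A` with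
`α = C_k‖z‖ + 2νπ²|k|²`, `β = 2νπ²|k|² + (2η)⁻¹` (Robinson–Rodrigo–Sadowski 2016, (4.12)–(4.13):
the time derivatives of the Galerkin coefficients are controlled by the energy bounds;
Constantin–Foias 1988, (8.17); Hopf 1951, §4). [cite: RobinsonRodrigoSadowski2016, Thm. 4.4 Step 3 (4.12)–(4.13)] -/
theorem IsHopfGalerkinScheme.abs_re_inner_mFourierCoeff_sub_le
    (hS : IsHopfGalerkinScheme ν f u₀ N F U) (hν : 0 ≤ ν) (n : ℕ) {T : ℝ} {A : ℝ≥0∞} (hA : A ≠ ⊤)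
    (hFA : ∫⁻ τ in Ioo 0 T, ∫⁻ x, ‖F n τ x‖ₑ ^ 2 ≤ A) {Y : ℝ}
    (hY : ∀ τ ∈ Icc 0 T, ∫ x, ‖U n τ x‖ ^ 2 ≤ Y) {k : d → ℤ} (hk : k ∈ FunctionSpaces.Torus.freqBall (N n))
    {z : EuclideanSpace ℂ d} (hz : ∑ j, (k j : ℂ) * z j = 0) {s t : ℝ} (hs : 0 ≤ s) (hst : s ≤ t)
    (htT : t ≤ T) {η : ℝ} (hη : 0 < η) :
    |(inner ℂ (mFourierCoeff (FunctionSpaces.EuclideanSpace.complexify ∘ U n t) k -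
        mFourierCoeff (FunctionSpaces.EuclideanSpace.complexify ∘ U n s) k) z).re| ≤
      (t - s) * ((Fintype.card d * (2 * Real.pi * Real.sqrt (FunctionSpaces.Torus.freqNormSq k) * ‖z‖) +
          ν * (2 * Real.pi ^ 2 * FunctionSpaces.Torus.freqNormSq k)) * Y +
        (ν * (2 * Real.pi ^ 2 * FunctionSpaces.Torus.freqNormSq k) + (2 * η)⁻¹) * ‖z‖ ^ 2) +
        η / 2 * A.toReal := by
  set α := Fintype.card d * (2 * Real.pi * Real.sqrt (FunctionSpaces.Torus.freqNormSq k) * ‖z‖) +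
    ν * (2 * Real.pi ^ 2 * FunctionSpaces.Torus.freqNormSq k) with hα
  set β := (ν * (2 * Real.pi ^ 2 * FunctionSpaces.Torus.freqNormSq k) + (2 * η)⁻¹) * ‖z‖ ^ 2 with hβ
  have hα0 : 0 ≤ α := by
    have := FunctionSpaces.Torus.freqNormSq_nonneg k
    positivity
  rw [hS.re_inner_mFourierCoeff_sub_eq n hk hz hs hst]
  -- the dominating function `τ ↦ α Y + β + (η/2) φ(τ)` on `[s, t]`
  have hFc := hS.continuousOn_force n
  have hφc : ContinuousOn (fun τ => ∫ x, ‖F n τ x‖ ^ 2) (Icc s t) :=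
    (FunctionSpaces.Torus.continuousOn_integral_norm_sq_of_continuousOn_stLift hFc).mono
      fun τ hτ => mem_Ici.2 (hs.trans hτ.1)
  have hI : ∀ {g : ℝ → ℝ}, ContinuousOn g (Icc s t) → IntervalIntegrable g volume s t :=
    fun hg => (hg.mono (by rw [uIcc_of_le hst])).intervalIntegrable
  have hgc : ContinuousOn (fun τ => α * Y + β + η / 2 * ∫ x, ‖F n τ x‖ ^ 2) (Icc s t) :=
    continuousOn_const.add (continuousOn_const.fun_mul hφc)
  have hdom : ∀ᵐ τ ∂volume, τ ∈ Ioc s t →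
      ‖∫ x, (⟪U n τ x, FunctionSpaces.Torus.convect (U n τ) (FunctionSpaces.Torus.realTrigPoly {k} fun _ => z) x⟫ +
        ν * ⟪U n τ x, FunctionSpaces.Torus.laplacian (FunctionSpaces.Torus.realTrigPoly {k} fun _ => z) x⟫ +
        ⟪F n τ x, FunctionSpaces.Torus.realTrigPoly {k} (fun _ => z) x⟫)‖ ≤
      α * Y + β + η / 2 * ∫ x, ‖F n τ x‖ ^ 2 := by
    refine ae_of_all _ fun τ hτ => ?_
    have hτ0 : 0 ≤ τ := hs.trans hτ.1.le
    rw [Real.norm_eq_abs]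
    refine (hS.abs_integral_galerkin_singleton_le hν n k z hη hτ0).trans ?_
    have hy := hY τ ⟨hτ0, hτ.2.trans htT⟩
    have : α * (∫ x, ‖U n τ x‖ ^ 2) ≤ α * Y := mul_le_mul_of_nonneg_left hy hα0
    linarith
  have h1 := intervalIntegral.norm_integral_le_of_norm_le hst hdom (hI hgc)
  rw [Real.norm_eq_abs] at h1
  refine h1.trans ?_
  rw [intervalIntegral.integral_add (hI continuousOn_const) ((hI hφc).const_mul _),
    intervalIntegral.integral_const, intervalIntegral.integral_const_mul, smul_eq_mul]
  -- the force part
  have h3 : ∫ τ in s..t, ∫ x, ‖F n τ x‖ ^ 2 ≤ A.toReal := by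
    obtain ⟨-, heq⟩ := intervalIntegral_norm_sq_eq_toReal hFc hs hst
    rw [heq]
    refine ENNReal.toReal_mono hA ((lintegral_mono_set ?_).trans hFA)
    exact Ioo_subset_Ioo hs (htT)
  have hη2 : 0 ≤ η / 2 := by positivity
  have h4 := mul_le_mul_of_nonneg_left h3 hη2
  linarith

/-- **L2: uniform equicontinuity of the Fourier coefficients** (Robinson–Rodrigo–Sadowski 2016,
Thm. 4.4 Step 3 and Ex. 4.2; Constantin–Foias 1988, (8.17); Hopf 1951, §4: the coefficient
curves `t ↦ Û_n(t,k)` are equicontinuous on every `[0, T]`, uniformly in `n`). For `ν ≥ 0`,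
`u₀ ∈ L²`, `f ∈ L²ₜL²ₓ`, every `T > 0`, frequency `k` and `ε > 0` there is `δ > 0` with
`‖Û_n(t,k) - Û_n(s,k)‖ < ε` whenever `0 ≤ s ≤ t ≤ T`, `t - s < δ` and `|k| ≤ N n` (test the
Galerkin equations with `z = Û_n(t,k) - Û_n(s,k)`, transversal since the slices are divergence
free; `abs_re_inner_mFourierCoeff_sub_le` with `η` small, then `t - s` small). [cite: RobinsonRodrigoSadowski2016, Thm. 4.4 Step 3, Ex. 4.2] -/
theorem IsHopfGalerkinScheme.equicontinuous_mFourierCoeff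
    (hS : IsHopfGalerkinScheme ν f u₀ N F U) (hν : 0 ≤ ν) (hu₀ : MemLp u₀ 2 volume)
    (hfm : AEStronglyMeasurable (FunctionSpaces.Torus.stLift f) (volume.restrict (Ioi 0 ×ˢ univ)))
    (hf₂ : ∀ T, 0 < T → ∫⁻ t in Ioo 0 T, ∫⁻ x, ‖f t x‖ₑ ^ 2 < ⊤) {T : ℝ} (hT : 0 < T)
    (k : d → ℤ) {ε : ℝ} (hε : 0 < ε) :
    ∃ δ > 0, ∀ n, k ∈ FunctionSpaces.Torus.freqBall (N n) → ∀ s t, 0 ≤ s → s ≤ t → t ≤ T → t - s < δ →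
      ‖mFourierCoeff (FunctionSpaces.EuclideanSpace.complexify ∘ U n t) k -
        mFourierCoeff (FunctionSpaces.EuclideanSpace.complexify ∘ U n s) k‖ < ε := by
  obtain ⟨A, hA, hFA⟩ := hS.exists_force_bound hfm hf₂ hT
  -- the uniform kinetic bound (an opaque abbreviation `Y`, no `let` value)
  obtain ⟨Y, hYdef⟩ : ∃ Y : ℝ, Y = 2 * (∫ x, ‖u₀ x‖ ^ 2) + 4 * T * A.toReal := ⟨_, rfl⟩
  have hY0 : 0 ≤ Y := by
    have : 0 ≤ ∫ x, ‖u₀ x‖ ^ 2 := integral_nonneg fun x => by positivity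
    rw [hYdef]; positivity
  have hY : ∀ n, ∀ τ ∈ Icc 0 T, ∫ x, ‖U n τ x‖ ^ 2 ≤ Y := fun n τ hτ =>
    (hS.integral_norm_sq_le hν hT hA n (hFA n) hτ).trans (by
      have := hS.integral_norm_sq_zero_le hu₀ n
      rw [hYdef]; linarith)
  -- constants independent of `z` (using `‖z‖ ≤ (1 + 4Y)/2`, `‖z‖² ≤ 4Y`)
  obtain ⟨Ck, hCk⟩ : ∃ Ck : ℝ,
      Ck = Fintype.card d * (2 * Real.pi * Real.sqrt (FunctionSpaces.Torus.freqNormSq k)) := ⟨_, rfl⟩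
  obtain ⟨L, hL⟩ : ∃ L : ℝ, L = ν * (2 * Real.pi ^ 2 * FunctionSpaces.Torus.freqNormSq k) := ⟨_, rfl⟩
  have hCk0 : 0 ≤ Ck := by rw [hCk]; positivity
  have hL0 : 0 ≤ L := by have := FunctionSpaces.Torus.freqNormSq_nonneg k; rw [hL]; positivity
  -- choose `η` with `(η/2) A < ε²/2`, then `δ`
  have hA0 : 0 ≤ A.toReal := ENNReal.toReal_nonneg
  obtain ⟨η, hηdef⟩ : ∃ η : ℝ, η = ε ^ 2 / (A.toReal + 1) := ⟨_, rfl⟩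
  have hη : 0 < η := by rw [hηdef]; positivity
  have hηA : η / 2 * A.toReal < ε ^ 2 / 2 := by
    have h1 : η / 2 * A.toReal = ε ^ 2 / 2 * (A.toReal / (A.toReal + 1)) := by
      rw [hηdef]; ring
    rw [h1]
    have h2 : A.toReal / (A.toReal + 1) < 1 := (div_lt_one (by positivity)).2 (lt_add_one _)
    have h3 : 0 < ε ^ 2 / 2 := by positivity
    exact mul_lt_of_lt_one_right h3 h2
  obtain ⟨K, hKdef⟩ : ∃ K : ℝ,
      K = (Ck * ((1 + 4 * Y) / 2) + L) * Y + (L + (2 * η)⁻¹) * (4 * Y) := ⟨_, rfl⟩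
  have hK0 : 0 ≤ K := by rw [hKdef]; positivity
  have hK1 : 0 < K + 1 := by linarith
  refine ⟨ε ^ 2 / (2 * (K + 1)), by positivity, fun n hk s t hs hst htT hδ => ?_⟩
  obtain ⟨z, hz⟩ : ∃ z : EuclideanSpace ℂ d,
      z = mFourierCoeff (FunctionSpaces.EuclideanSpace.complexify ∘ U n t) k -
        mFourierCoeff (FunctionSpaces.EuclideanSpace.complexify ∘ U n s) k := ⟨_, rfl⟩
  rw [← hz]
  -- `z` is transversal
  have hzT : ∑ j, (k j : ℂ) * z j = 0 := by
    simp only [hz, PiLp.sub_apply, mul_sub, Finset.sum_sub_distrib]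
    rw [hS.sum_mul_mFourierCoeff_eq_zero n (hs.trans hst) k, hS.sum_mul_mFourierCoeff_eq_zero n hs k,
      sub_zero]
  -- size of `z`
  have hzsq : ‖z‖ ^ 2 ≤ 4 * Y := by
    have ht' : t ∈ Icc 0 T := ⟨hs.trans hst, htT⟩
    have hs' : s ∈ Icc 0 T := ⟨hs, hst.trans htT⟩
    have h1 := (hS.norm_mFourierCoeff_sq_le n (hs.trans hst) k).trans (hY n t ht')
    have h2 := (hS.norm_mFourierCoeff_sq_le n hs k).trans (hY n s hs')
    have h3 : ‖z‖ ≤ ‖mFourierCoeff (FunctionSpaces.EuclideanSpace.complexify ∘ U n t) k‖ +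
        ‖mFourierCoeff (FunctionSpaces.EuclideanSpace.complexify ∘ U n s) k‖ := by
      rw [hz]; exact norm_sub_le _ _
    have h4 : ‖z‖ ^ 2 ≤ (‖mFourierCoeff (FunctionSpaces.EuclideanSpace.complexify ∘ U n t) k‖ +
        ‖mFourierCoeff (FunctionSpaces.EuclideanSpace.complexify ∘ U n s) k‖) ^ 2 :=
      pow_le_pow_left₀ (norm_nonneg _) h3 2
    nlinarith [h4, sq_nonneg (‖mFourierCoeff (FunctionSpaces.EuclideanSpace.complexify ∘ U n t) k‖ -
      ‖mFourierCoeff (FunctionSpaces.EuclideanSpace.complexify ∘ U n s) k‖)]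
  have hz1 : ‖z‖ ≤ (1 + 4 * Y) / 2 := by nlinarith [sq_nonneg (‖z‖ - 1), norm_nonneg z]
  -- the quantitative bound with this `z`
  have hmain := hS.abs_re_inner_mFourierCoeff_sub_le hν n hA (hFA n) (hY n) hk hzT hs hst htT hη
  rw [← hz] at hmain
  have hre : (inner ℂ z z).re = ‖z‖ ^ 2 := by rw [inner_self_eq_norm_sq_to_K]; norm_cast
  rw [hre, abs_of_nonneg (sq_nonneg _)] at hmain
  -- compare the coefficient of `(t - s)` with `K`
  have hcoef : (Fintype.card d * (2 * Real.pi * Real.sqrt (FunctionSpaces.Torus.freqNormSq k) * ‖z‖) +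
      ν * (2 * Real.pi ^ 2 * FunctionSpaces.Torus.freqNormSq k)) * Y +
      (ν * (2 * Real.pi ^ 2 * FunctionSpaces.Torus.freqNormSq k) + (2 * η)⁻¹) * ‖z‖ ^ 2 ≤ K := by
    have e1 : Fintype.card d * (2 * Real.pi * Real.sqrt (FunctionSpaces.Torus.freqNormSq k) * ‖z‖) =
        Ck * ‖z‖ := by
      rw [hCk]; ring
    rw [hKdef, e1, ← hL]
    have hη' : 0 ≤ (2 * η)⁻¹ := by positivity
    have i0 : Ck * ‖z‖ ≤ Ck * ((1 + 4 * Y) / 2) := mul_le_mul_of_nonneg_left hz1 hCk0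
    have i1 : (Ck * ‖z‖ + L) * Y ≤ (Ck * ((1 + 4 * Y) / 2) + L) * Y :=
      mul_le_mul_of_nonneg_right (by linarith) hY0
    have i2 : (L + (2 * η)⁻¹) * ‖z‖ ^ 2 ≤ (L + (2 * η)⁻¹) * (4 * Y) :=
      mul_le_mul_of_nonneg_left hzsq (by positivity)
    linarith
  have hts : 0 ≤ t - s := sub_nonneg.2 hst
  have hsq : ‖z‖ ^ 2 < ε ^ 2 := by
    have h1 : (t - s) * K < ε ^ 2 / 2 := by
      have hK1' : K + 1 ≠ 0 := hK1.ne'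
      calc (t - s) * K ≤ (t - s) * (K + 1) := mul_le_mul_of_nonneg_left (by linarith) hts
        _ < ε ^ 2 / (2 * (K + 1)) * (K + 1) := mul_lt_mul_of_pos_right hδ hK1
        _ = ε ^ 2 / 2 := by field_simp
    calc ‖z‖ ^ 2 ≤ (t - s) * ((Fintype.card d * (2 * Real.pi * Real.sqrt (FunctionSpaces.Torus.freqNormSq k) * ‖z‖) +
          ν * (2 * Real.pi ^ 2 * FunctionSpaces.Torus.freqNormSq k)) * Y +
          (ν * (2 * Real.pi ^ 2 * FunctionSpaces.Torus.freqNormSq k) + (2 * η)⁻¹) * ‖z‖ ^ 2) +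
          η / 2 * A.toReal := hmain
      _ ≤ (t - s) * K + η / 2 * A.toReal := by gcongr
      _ < ε ^ 2 / 2 + ε ^ 2 / 2 := add_lt_add h1 hηA
      _ = ε ^ 2 := by ring
  have h := abs_lt_of_sq_lt_sq hsq hε.le
  rwa [abs_of_nonneg (norm_nonneg _)] at h

end Modulus

/-! ## L3: extraction of a subsequence converging at every time and frequency -/

section Extraction

variable {ν : ℝ} {f : ℝ → UnitAddTorus d → EuclideanSpace ℝ d}
  {u₀ : UnitAddTorus d → EuclideanSpace ℝ d} {N : ℕ → ℕ}
  {F U : ℕ → ℝ → UnitAddTorus d → EuclideanSpace ℝ d}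

/-- Every frequency eventually lies in the Galerkin balls: `|k| ≤ N n` for all large `n`
(`N n → ∞`). [folklore] -/
theorem IsHopfGalerkinScheme.eventually_mem_freqBall (hS : IsHopfGalerkinScheme ν f u₀ N F U)
    (k : d → ℤ) : ∀ᶠ n in atTop, k ∈ FunctionSpaces.Torus.freqBall (N n) := by
  obtain ⟨M, hM⟩ := exists_nat_ge (FunctionSpaces.Torus.freqNormSq k)
  filter_upwards [hS.tendsto_order.eventually (eventually_ge_atTop (M + 1))] with n hn
  rw [FunctionSpaces.Torus.mem_freqBall]
  have h1 : (M : ℝ) + 1 ≤ N n := by exact_mod_cast hn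
  have hM0 : (0 : ℝ) ≤ M := Nat.cast_nonneg M
  nlinarith

/-- **Uniform bound on the Fourier coefficients at a fixed time**: for every `t ≥ 0` there is
`R` with `‖Û_n(t,k)‖ ≤ R` for all `n` and `k` (`‖Û_n(t,k)‖² ≤ ∫ ‖U n t‖² ≤ 2∫‖u₀‖² + 4TA_T`). [folklore] -/
theorem IsHopfGalerkinScheme.exists_norm_mFourierCoeff_le (hS : IsHopfGalerkinScheme ν f u₀ N F U)
    (hν : 0 ≤ ν) (hu₀ : MemLp u₀ 2 volume)
    (hfm : AEStronglyMeasurable (FunctionSpaces.Torus.stLift f) (volume.restrict (Ioi 0 ×ˢ univ)))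
    (hf₂ : ∀ T, 0 < T → ∫⁻ t in Ioo 0 T, ∫⁻ x, ‖f t x‖ₑ ^ 2 < ⊤) {t : ℝ} (ht : 0 ≤ t) :
    ∃ R : ℝ, ∀ n k, ‖mFourierCoeff (FunctionSpaces.EuclideanSpace.complexify ∘ U n t) k‖ ≤ R := by
  have hT : 0 < t + 1 := by linarith
  obtain ⟨A, hA, hFA⟩ := hS.exists_force_bound hfm hf₂ hT
  set Y : ℝ := 2 * (∫ x, ‖u₀ x‖ ^ 2) + 4 * (t + 1) * A.toReal with hYdef
  refine ⟨Real.sqrt Y, fun n k => ?_⟩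
  have hY : ∫ x, ‖U n t x‖ ^ 2 ≤ Y :=
    (hS.integral_norm_sq_le hν hT hA n (hFA n) ⟨ht, by linarith⟩).trans (by
      have := hS.integral_norm_sq_zero_le hu₀ n
      rw [hYdef]; linarith)
  exact Real.le_sqrt_of_sq_le ((hS.norm_mFourierCoeff_sq_le n ht k).trans hY)

/-- **L3: extraction** (Robinson–Rodrigo–Sadowski 2016, Thm. 4.4 Step 3 with Exercises 4.2–4.4
"Hopf's method"; Constantin–Foias 1988, proof of Lemma 8.2/8.4; Hopf 1951, §4: Arzelà–Ascoli for
the coefficient curves and a diagonal argument). For a Hopf–Galerkin scheme with `ν ≥ 0`,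
`u₀ ∈ L²` and `f ∈ L²ₜL²ₓ` there are a subsequence `φ` and limit coefficients
`c : [0, ∞) × ℤ^d → ℂ^d` with `Û_{φ j}(t, k) → c t k` for **every** `t ≥ 0` and every `k`.
Proof: by Tychonoff (`isCompact_univ_pi`) and `IsCompact.tendsto_subseq` in the first-countable
space `(ℚ × ℤ^d) → ℂ^d`, a subsequence converges at all rational times; by the uniform
equicontinuity `equicontinuous_mFourierCoeff` the subsequence is Cauchy at every real time. [cite: RobinsonRodrigoSadowski2016, Thm. 4.4 Step 3, Ex. 4.2–4.4] -/
theorem IsHopfGalerkinScheme.exists_subseq_tendsto_mFourierCoeff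
    (hS : IsHopfGalerkinScheme ν f u₀ N F U) (hν : 0 ≤ ν) (hu₀ : MemLp u₀ 2 volume)
    (hfm : AEStronglyMeasurable (FunctionSpaces.Torus.stLift f) (volume.restrict (Ioi 0 ×ˢ univ)))
    (hf₂ : ∀ T, 0 < T → ∫⁻ t in Ioo 0 T, ∫⁻ x, ‖f t x‖ₑ ^ 2 < ⊤) :
    ∃ φ : ℕ → ℕ, StrictMono φ ∧ ∃ c : ℝ → (d → ℤ) → EuclideanSpace ℂ d,
      ∀ t, 0 ≤ t → ∀ k, Tendsto (fun j => mFourierCoeff (FunctionSpaces.EuclideanSpace.complexify ∘ U (φ j) t) k)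
        atTop (𝓝 (c t k)) := by
  -- uniform bounds at every (rational) time
  have hb : ∀ t : ℝ, ∃ R : ℝ, 0 ≤ t → ∀ n k,
      ‖mFourierCoeff (FunctionSpaces.EuclideanSpace.complexify ∘ U n t) k‖ ≤ R := by
    intro t
    by_cases ht : 0 ≤ t
    · obtain ⟨R, hR⟩ := hS.exists_norm_mFourierCoeff_le hν hu₀ hfm hf₂ ht
      exact ⟨R, fun _ => hR⟩
    · exact ⟨0, fun h => absurd h ht⟩
  choose R hR using hb
  -- the sequence in the product space over the countable index set `ℚ × ℤ^d`
  let x : ℕ → (ℚ × (d → ℤ)) → EuclideanSpace ℂ d := fun n p =>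
    mFourierCoeff (FunctionSpaces.EuclideanSpace.complexify ∘ U n (max (p.1 : ℝ) 0)) p.2
  let s : Set ((ℚ × (d → ℤ)) → EuclideanSpace ℂ d) :=
    Set.pi univ fun p => Metric.closedBall 0 (R (max (p.1 : ℝ) 0))
  have hs : IsCompact s := isCompact_univ_pi fun p => isCompact_closedBall _ _
  have hx : ∀ n, x n ∈ s := fun n => by
    refine mem_univ_pi.2 fun p => ?_
    rw [Metric.mem_closedBall, dist_zero_right]
    exact hR _ (le_max_right _ _) n p.2
  obtain ⟨a, -, φ, hφ, hlim⟩ := hs.tendsto_subseq hx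
  rw [tendsto_pi_nhds] at hlim
  -- convergence at rational times `q ≥ 0`
  have hrat : ∀ (q : ℚ), (0 : ℝ) ≤ q → ∀ k,
      Tendsto (fun j => mFourierCoeff (FunctionSpaces.EuclideanSpace.complexify ∘ U (φ j) q) k) atTop
        (𝓝 (a (q, k))) := by
    intro q hq k
    have h := hlim (q, k)
    have heq : (fun j => x (φ j) (q, k)) =
        fun j => mFourierCoeff (FunctionSpaces.EuclideanSpace.complexify ∘ U (φ j) q) k := by
      funext j
      simp only [x, max_eq_left hq]
    rw [← heq]
    exact h
  -- the subsequence is Cauchy at every real time `t ≥ 0`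
  have hcauchy : ∀ t, 0 ≤ t → ∀ k,
      CauchySeq fun j => mFourierCoeff (FunctionSpaces.EuclideanSpace.complexify ∘ U (φ j) t) k := by
    intro t ht k
    rw [Metric.cauchySeq_iff]
    intro ε hε
    have hT : 0 < t + 1 := by linarith
    obtain ⟨δ, hδ, hmod⟩ := hS.equicontinuous_mFourierCoeff hν hu₀ hfm hf₂ hT k
      (by positivity : 0 < ε / 3)
    obtain ⟨q, hq1, hq2⟩ := exists_rat_btwn (show t < t + min δ 1 by
      have := min_le_right δ 1; linarith [lt_min hδ one_pos])
    have hq0 : (0 : ℝ) ≤ q := ht.trans hq1.le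
    have hqT : (q : ℝ) ≤ t + 1 := by linarith [min_le_right δ 1]
    have hqt : (q : ℝ) - t < δ := by linarith [min_le_left δ 1]
    -- eventually `k` is in the ball of the subsequence, and the values at `q` are Cauchy
    have hball : ∀ᶠ j in atTop, k ∈ FunctionSpaces.Torus.freqBall (N (φ j)) :=
      hφ.tendsto_atTop.eventually (hS.eventually_mem_freqBall k)
    have hcq := (hrat q hq0 k).cauchySeq
    rw [Metric.cauchySeq_iff] at hcq
    obtain ⟨N₁, hN₁⟩ := hcq (ε / 3) (by positivity)
    obtain ⟨N₂, hN₂⟩ := eventually_atTop.1 hball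
    refine ⟨max N₁ N₂, fun m hm n hn => ?_⟩
    have hm1 : N₁ ≤ m := (le_max_left _ _).trans hm
    have hn1 : N₁ ≤ n := (le_max_left _ _).trans hn
    have hm2 : k ∈ FunctionSpaces.Torus.freqBall (N (φ m)) := hN₂ m ((le_max_right _ _).trans hm)
    have hn2 : k ∈ FunctionSpaces.Torus.freqBall (N (φ n)) := hN₂ n ((le_max_right _ _).trans hn)
    have e1 := hmod (φ m) hm2 t q ht hq1.le hqT hqt
    have e2 := hN₁ m hm1 n hn1
    have e3 := hmod (φ n) hn2 t q ht hq1.le hqT hqt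
    rw [dist_eq_norm] at e2 ⊢
    calc ‖mFourierCoeff (FunctionSpaces.EuclideanSpace.complexify ∘ U (φ m) t) k -
          mFourierCoeff (FunctionSpaces.EuclideanSpace.complexify ∘ U (φ n) t) k‖
        = ‖-(mFourierCoeff (FunctionSpaces.EuclideanSpace.complexify ∘ U (φ m) q) k -
              mFourierCoeff (FunctionSpaces.EuclideanSpace.complexify ∘ U (φ m) t) k) +
            (mFourierCoeff (FunctionSpaces.EuclideanSpace.complexify ∘ U (φ m) q) k -
              mFourierCoeff (FunctionSpaces.EuclideanSpace.complexify ∘ U (φ n) q) k) +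
            (mFourierCoeff (FunctionSpaces.EuclideanSpace.complexify ∘ U (φ n) q) k -
              mFourierCoeff (FunctionSpaces.EuclideanSpace.complexify ∘ U (φ n) t) k)‖ := by
          congr 1; abel
      _ ≤ ‖-(mFourierCoeff (FunctionSpaces.EuclideanSpace.complexify ∘ U (φ m) q) k -
              mFourierCoeff (FunctionSpaces.EuclideanSpace.complexify ∘ U (φ m) t) k)‖ +
            ‖mFourierCoeff (FunctionSpaces.EuclideanSpace.complexify ∘ U (φ m) q) k -
              mFourierCoeff (FunctionSpaces.EuclideanSpace.complexify ∘ U (φ n) q) k‖ +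
            ‖mFourierCoeff (FunctionSpaces.EuclideanSpace.complexify ∘ U (φ n) q) k -
              mFourierCoeff (FunctionSpaces.EuclideanSpace.complexify ∘ U (φ n) t) k‖ :=
          norm_add₃_le
      _ < ε / 3 + ε / 3 + ε / 3 := by
          rw [norm_neg]
          exact add_lt_add (add_lt_add e1 e2) e3
      _ = ε := by ring
  refine ⟨φ, hφ, fun t k => limUnder atTop
    (fun j => mFourierCoeff (FunctionSpaces.EuclideanSpace.complexify ∘ U (φ j) t) k), fun t ht k => ?_⟩
  exact tendsto_nhds_limUnder (cauchySeq_tendsto_of_complete (hcauchy t ht k))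

end Extraction

/-! ## The limit coefficients -/

section LimitCoefficients

variable {ν : ℝ} {f : ℝ → UnitAddTorus d → EuclideanSpace ℝ d}
  {u₀ : UnitAddTorus d → EuclideanSpace ℝ d} {N : ℕ → ℕ}
  {F U : ℕ → ℝ → UnitAddTorus d → EuclideanSpace ℝ d}
  {c : ℝ → (d → ℤ) → EuclideanSpace ℂ d}

/-- **The limit coefficients at time `0` are those of the datum**: `c 0 k = û₀(k)`
(`Û_n(0,k) = û₀(k)` as soon as `|k| ≤ N n`). [folklore] -/
theorem IsHopfGalerkinScheme.limit_zero_eq (hS : IsHopfGalerkinScheme ν f u₀ N F U)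
    (hu₀ : MemLp u₀ 2 volume) (hdiv : FunctionSpaces.Torus.IsWeaklyDivFree u₀)
    (hc : ∀ t, 0 ≤ t → ∀ k, Tendsto (fun n => mFourierCoeff (FunctionSpaces.EuclideanSpace.complexify ∘ U n t) k)
      atTop (𝓝 (c t k))) (k : d → ℤ) :
    c 0 k = mFourierCoeff (FunctionSpaces.EuclideanSpace.complexify ∘ u₀) k := by
  refine tendsto_nhds_unique (hc 0 le_rfl k) (tendsto_const_nhds.congr' ?_)
  filter_upwards [hS.eventually_mem_freqBall k] with n hn
  exact (hS.mFourierCoeff_zero_eq hu₀ hdiv n hn).symm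

/-- **The limit coefficients are transversal**: `∑ⱼ kⱼ (c t k)ⱼ = 0` for `t ≥ 0` (limit of the
transversality of the `Û_n(t,k)`). [folklore] -/
theorem IsHopfGalerkinScheme.sum_mul_limit_eq_zero (hS : IsHopfGalerkinScheme ν f u₀ N F U)
    (hc : ∀ t, 0 ≤ t → ∀ k, Tendsto (fun n => mFourierCoeff (FunctionSpaces.EuclideanSpace.complexify ∘ U n t) k)
      atTop (𝓝 (c t k))) {t : ℝ} (ht : 0 ≤ t) (k : d → ℤ) :
    ∑ j, (k j : ℂ) * c t k j = 0 := by
  have hcont : Continuous fun w : EuclideanSpace ℂ d => ∑ j, (k j : ℂ) * w j :=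
    continuous_finsetSum _ fun j _ => continuous_const.mul (EuclideanSpace.proj j).continuous
  have h1 : Tendsto (fun n => ∑ j, (k j : ℂ) * mFourierCoeff (FunctionSpaces.EuclideanSpace.complexify ∘ U n t) k j)
      atTop (𝓝 (∑ j, (k j : ℂ) * c t k j)) := (hcont.tendsto _).comp (hc t ht k)
  have h2 : (fun n => ∑ j, (k j : ℂ) * mFourierCoeff (FunctionSpaces.EuclideanSpace.complexify ∘ U n t) k j) =
      fun _ => 0 := funext fun n => hS.sum_mul_mFourierCoeff_eq_zero n ht k
  rw [h2] at h1
  exact (tendsto_nhds_unique h1 tendsto_const_nhds)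

/-- **The limit coefficients are conjugate symmetric**: `c t (-k) = conj (c t k)` for `t ≥ 0`
(limit of the reality condition of the `Û_n(t,·)`). [folklore] -/
theorem IsHopfGalerkinScheme.isConjSymm_limit (hS : IsHopfGalerkinScheme ν f u₀ N F U)
    (hc : ∀ t, 0 ≤ t → ∀ k, Tendsto (fun n => mFourierCoeff (FunctionSpaces.EuclideanSpace.complexify ∘ U n t) k)
      atTop (𝓝 (c t k))) {t : ℝ} (ht : 0 ≤ t) : FunctionSpaces.Torus.IsConjSymm (c t) := by
  intro k
  have h1 : Tendsto (fun n => mFourierCoeff (FunctionSpaces.EuclideanSpace.complexify ∘ U n t) (-k)) atTop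
      (𝓝 (FunctionSpaces.EuclideanSpace.conjVec (c t k))) := by
    have h := ((FunctionSpaces.EuclideanSpace.conjVecL (ι := d)).continuous.tendsto _).comp (hc t ht k)
    refine h.congr fun n => ?_
    simp only [Function.comp_apply, FunctionSpaces.EuclideanSpace.conjVecL_apply]
    exact ((hS.isConjSymm_mFourierCoeff n ht) k).symm
  exact tendsto_nhds_unique (hc t ht (-k)) h1

/-- **Finite Parseval sums of the limit coefficients obey the uniform energy bound**: for
`t ∈ [0, T]` and every finite set of frequencies `S`,
`∑_{k∈S} ‖c t k‖² ≤ 2 ∫ ‖u₀‖² + 4 T A` whenever `∫⁻_{(0,T)} ∫⁻ ‖F n‖ₑ² ≤ A` for all `n`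
(finite sums pass to the limit; Robinson–Rodrigo–Sadowski 2016, (4.8) for the limit, "norms are
lower semicontinuous under weak convergence"). [cite: RobinsonRodrigoSadowski2016, Thm. 4.4 Step 3 (4.8)] -/
theorem IsHopfGalerkinScheme.sum_norm_sq_limit_le (hS : IsHopfGalerkinScheme ν f u₀ N F U)
    (hν : 0 ≤ ν) (hu₀ : MemLp u₀ 2 volume)
    (hc : ∀ t, 0 ≤ t → ∀ k, Tendsto (fun n => mFourierCoeff (FunctionSpaces.EuclideanSpace.complexify ∘ U n t) k)
      atTop (𝓝 (c t k))) {T : ℝ} (hT : 0 < T) {A : ℝ≥0∞} (hA : A ≠ ⊤)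
    (hFA : ∀ n, ∫⁻ τ in Ioo 0 T, ∫⁻ x, ‖F n τ x‖ₑ ^ 2 ≤ A) {t : ℝ} (ht : t ∈ Icc 0 T)
    (S : Finset (d → ℤ)) :
    ∑ k ∈ S, ‖c t k‖ ^ 2 ≤ 2 * (∫ x, ‖u₀ x‖ ^ 2) + 4 * T * A.toReal := by
  have hlim : Tendsto (fun n => ∑ k ∈ S, ‖mFourierCoeff (FunctionSpaces.EuclideanSpace.complexify ∘ U n t) k‖ ^ 2)
      atTop (𝓝 (∑ k ∈ S, ‖c t k‖ ^ 2)) :=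
    tendsto_finsetSum _ fun k _ => ((hc t ht.1 k).norm).pow 2
  refine le_of_tendsto' hlim fun n => ?_
  have h1 : ∑ k ∈ S, ‖mFourierCoeff (FunctionSpaces.EuclideanSpace.complexify ∘ U n t) k‖ ^ 2 ≤
      ∫ x, ‖U n t x‖ ^ 2 :=
    sum_le_hasSum S (fun k _ => sq_nonneg _)
      (FunctionSpaces.Torus.hasSum_sq_norm_mFourierCoeff_complexify (hS.memLp_slice n ht.1))
  refine h1.trans ((hS.integral_norm_sq_le hν hT hA n (hFA n) ht).trans ?_)
  have := hS.integral_norm_sq_zero_le hu₀ n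
  linarith

/-- **The limit coefficients are continuous in time** on `[0, ∞)` (the uniform modulus of
`equicontinuous_mFourierCoeff` passes to the limit; Robinson–Rodrigo–Sadowski 2016, Ex. 4.3;
Hopf 1951, §4). [cite: RobinsonRodrigoSadowski2016, Thm. 4.4 Step 3, Ex. 4.3] -/
theorem IsHopfGalerkinScheme.continuousOn_limit (hS : IsHopfGalerkinScheme ν f u₀ N F U)
    (hν : 0 ≤ ν) (hu₀ : MemLp u₀ 2 volume)
    (hfm : AEStronglyMeasurable (FunctionSpaces.Torus.stLift f) (volume.restrict (Ioi 0 ×ˢ univ)))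
    (hf₂ : ∀ T, 0 < T → ∫⁻ t in Ioo 0 T, ∫⁻ x, ‖f t x‖ₑ ^ 2 < ⊤)
    (hc : ∀ t, 0 ≤ t → ∀ k, Tendsto (fun n => mFourierCoeff (FunctionSpaces.EuclideanSpace.complexify ∘ U n t) k)
      atTop (𝓝 (c t k))) (k : d → ℤ) :
    ContinuousOn (fun t => c t k) (Ici 0) := by
  -- uniform modulus for the limit on every `[0, T]`
  have hmod : ∀ {T : ℝ}, 0 < T → ∀ {ε : ℝ}, 0 < ε → ∃ δ > 0, ∀ s t, 0 ≤ s → s ≤ t → t ≤ T →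
      t - s < δ → ‖c t k - c s k‖ ≤ ε := by
    intro T hT ε hε
    obtain ⟨δ, hδ, h⟩ := hS.equicontinuous_mFourierCoeff hν hu₀ hfm hf₂ hT k hε
    refine ⟨δ, hδ, fun s t hs hst htT hts => ?_⟩
    have hlim : Tendsto (fun n => ‖mFourierCoeff (FunctionSpaces.EuclideanSpace.complexify ∘ U n t) k -
        mFourierCoeff (FunctionSpaces.EuclideanSpace.complexify ∘ U n s) k‖) atTop (𝓝 ‖c t k - c s k‖) :=
      ((hc t (hs.trans hst) k).sub (hc s hs k)).norm
    refine le_of_tendsto hlim ?_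
    filter_upwards [hS.eventually_mem_freqBall k] with n hn
    exact (h n hn s t hs hst htT hts).le
  intro t₀ ht₀
  rw [mem_Ici] at ht₀
  rw [ContinuousWithinAt, Metric.tendsto_nhds]
  intro ε hε
  have hT : 0 < t₀ + 1 := by linarith
  obtain ⟨δ, hδ, h⟩ := hmod hT (half_pos hε)
  have hball : ∀ᶠ t in 𝓝[Ici 0] t₀, dist t t₀ < min δ 1 :=
    Metric.tendsto_nhds.1 tendsto_id _ (lt_min hδ one_pos) |>.filter_mono nhdsWithin_le_nhds
  filter_upwards [hball, self_mem_nhdsWithin] with t ht hts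
  rw [mem_Ici] at hts
  have hd1 : dist t t₀ < δ := lt_of_lt_of_le ht (min_le_left _ _)
  have hd2 : dist t t₀ < 1 := lt_of_lt_of_le ht (min_le_right _ _)
  rw [Real.dist_eq] at hd1 hd2
  rw [dist_eq_norm]
  rcases le_total t t₀ with hle | hle
  · have := h t t₀ hts hle (by linarith) (by rw [abs_lt] at hd1; linarith)
    rw [norm_sub_rev]
    linarith
  · have := h t₀ t ht₀ hle (by rw [abs_lt] at hd2; linarith) (by rw [abs_lt] at hd1; linarith)
    linarith

end LimitCoefficients

end Literature.Analysis.FluidPDE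

/-!
# Part 2 — the limit field of a Hopf–Galerkin scheme, Friedrichs' inequality and the a priori
  bounds of the limit

Trunk: FluidKinetic. Second part of the proof of the named fact `NS.hopf_galerkin_limit`
(`Literature/Analysis/FluidPDE/NSHopfGalerkin`), continuing Part 1: from a
Hopf–Galerkin scheme `(N, F, U)` (`NS.IsHopfGalerkinScheme ν f u₀ N F U`, `ν > 0`) and the
subsequence along which every Fourier coefficient `Û_n(t,k)` converges at every time
(`IsHopfGalerkinScheme.exists_subseq_tendsto_mFourierCoeff`) we build the **limit field** `u` and
prove the estimates of Hopf's existence proof that do not involve the equations any more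
(Hopf 1951, §4; Robinson–Rodrigo–Sadowski 2016, Thm. 4.4, Step 3, (4.10)–(4.13) and the proof of
Thm. 4.11 with Exercises 4.3–4.9 "Hopf's method"; Constantin–Foias 1988, Ch. 8, (8.10)–(8.16) and
Lemma 8.4), entirely on the Fourier side:

* `IsHopfGalerkinScheme.exists_limitField` — **the limit field**: a subsequence `φ` and a real
  field `u : ℝ → T^d → ℝ^d`, a.e. strongly measurable on `(0, ∞) × T^d`, with `u t ∈ L²` and
  `Û_{φ j}(t, k) → û(t, k)` for *every* `t ≥ 0` and `k ∈ ℤ^d` (Riesz–Fischer with an everywhere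
  representative, `Torus.exists_realField_forall_mFourierCoeff_eq`).
* consequences for any field `u` so related to a scheme (the standing hypotheses `hu`, `hc` of
  this file): transversal, conjugate-symmetric coefficients continuous in time; `u 0 = u₀` a.e.;
  every slice `u t`, `t ≥ 0`, is weakly divergence free (`Torus.isWeaklyDivFree_of_sum_mul`,
  RRS Lemma 2.3); the uniform `L²` bound `∫ ‖u t‖² ≤ 2‖u₀‖² + 4T·A_T` on `[0, T]`
  (RRS (4.10); CF (8.12));
* **Fatou for the dissipation**: `‖∇u(t)‖² ≤ liminf ‖∇U_n(t)‖²` mode by mode, hence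
  `∫₀ᵀ ‖∇u‖² ≤ (‖u₀‖² + 2T·A_T)/ν` (RRS (4.11); CF (8.13));
* **Friedrichs' inequality / strong convergence** (`IsHopfGalerkinScheme.tendsto_lintegral_sub`):
  `U_n → u` in `L²((0, T) × T^d)` — low modes by dominated convergence in time, high modes by
  the uniform `L²ₜH¹ₓ` bound `∑_{|k| > R} ≤ R⁻² ∑ |k|² |·|²` (RRS Thm. 4.11, proof, and Ex. 4.8–4.9;
  CF Lemma 8.4; Hopf 1951, §4, "Friedrichs' inequality").

The energy inequalities, weak continuity and the weak form of the equations for the limit are in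
the sequel modules `NSHopfEnergy`, `NSHopfGalerkinLimit`.

## Mathlib search

Mathlib (this pin): `MeasureTheory.lintegral_liminf_le'` (Fatou), `ENNReal.tsum_eq_iSup_sum`,
`MeasureTheory.tendsto_lintegral_of_dominated_convergence'`, `aestronglyMeasurable_of_tendsto_ae`;
no Aubin–Lions / Friedrichs lemma for Bochner spaces (searched `AubinLions`, `Friedrichs`:
nothing relevant), whence the Fourier-side route.

## References

* E. Hopf, *Über die Anfangswertaufgabe für die hydrodynamischen Grundgleichungen*, Math. Nachr.
  4 (1951), 213–231, §4.
* J. C. Robinson, J. L. Rodrigo, W. Sadowski, *The three-dimensional Navier–Stokes equations*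
  (CUP 2016), Lemma 2.3, Thm. 4.4 Step 3 (4.10)–(4.13), Thm. 4.11 (pp. 82–84), Exercises 4.3–4.9.
* P. Constantin, C. Foias, *Navier–Stokes Equations* (Chicago 1988), Ch. 8, (8.10)–(8.16),
  Lemma 8.4.
-/

open MeasureTheory TopologicalSpace Set Function Filter Topology UnitAddTorus
open scoped InnerProductSpace RealInnerProductSpace ENNReal NNReal ComplexConjugate

namespace Literature.Analysis.FluidPDE

/-! ## Preliminaries on `T^d`: transversal `L²` fields are weakly divergence free; Fatou for sums -/

namespace Torus

variable {d : Type*} [Fintype d] [DecidableEq d]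

/-- The coordinates of the gradient are the partial derivatives: `(∇θ(x))ⱼ = ∂ⱼθ(x)` for `C¹`
scalar `θ`. [folklore] -/
theorem gradient_apply_eq_partialDeriv {θ : UnitAddTorus d → ℝ} (hθ : FunctionSpaces.Torus.IsContDiff 1 θ)
    (x : UnitAddTorus d) (j : d) : FunctionSpaces.Torus.gradient θ x j = FunctionSpaces.Torus.partialDeriv j θ x := by
  have h := FunctionSpaces.Torus.inner_gradient_eq_sum_mul_partialDeriv hθ (EuclideanSpace.single j (1 : ℝ)) x
  rw [EuclideanSpace.inner_single_left, map_one, one_mul] at h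
  rw [h, Finset.sum_eq_single j (fun i _ hij => by simp [hij]) (by simp)]
  simp

/-- Fourier coefficients of a gradient: `𝓕(complexify ∘ ∇θ)(k)ⱼ = 2πi kⱼ 𝓕(θ)(k)` for smooth
real `θ` (Grafakos 2014, Prop. 3.2.6 (8), coordinatewise). [cite: Grafakos2014, Prop. 3.2.6 (8)] -/
theorem mFourierCoeff_complexify_gradient_apply {θ : UnitAddTorus d → ℝ} (hθ : FunctionSpaces.Torus.IsSmooth θ)
    (k : d → ℤ) (j : d) :
    mFourierCoeff (FunctionSpaces.EuclideanSpace.complexify ∘ FunctionSpaces.Torus.gradient θ) k j =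
      2 * Real.pi * Complex.I * (k j) * mFourierCoeff (fun x => (θ x : ℂ)) k := by
  rw [FunctionSpaces.Torus.mFourierCoeff_complexify_apply hθ.gradient.integrable]
  have h1 : (fun x => ((FunctionSpaces.Torus.gradient θ x) j : ℂ)) = FunctionSpaces.Torus.partialDeriv j (Complex.ofRealCLM ∘ θ) := by
    funext x
    rw [FunctionSpaces.Torus.partialDeriv_clm_comp hθ Complex.ofRealCLM j x,
      gradient_apply_eq_partialDeriv (hθ.isContDiff (by simp)) x j]
    rfl
  rw [h1, FunctionSpaces.Torus.mFourierCoeff_partialDeriv (hθ.comp_clm Complex.ofRealCLM) j k, smul_eq_mul]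
  rfl

omit [DecidableEq d] in
/-- **Transversal `L²` fields are weakly divergence free** (Robinson–Rodrigo–Sadowski 2016,
Lemma 2.3: `k · û_k = 0` for all `k` implies `∫ u · ∇φ = 0`; the converse of
`IsWeaklyDivFree.sum_mul_mFourierCoeff_eq_zero`). Proof: Parseval for `∫ ⟪u, ∇θ⟫` and
`𝓕(∇θ)(k) = 2πi k θ̂(k)`, so every term is `Re (2πi θ̂(k) · conj (∑ⱼ kⱼ ûⱼ(k))) = 0`.
[cite: RobinsonRodrigoSadowski2016, Lemma 2.3] -/
theorem isWeaklyDivFree_of_sum_mul_mFourierCoeff_eq_zero [DecidableEq d]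
    {u : UnitAddTorus d → EuclideanSpace ℝ d} (hu : MemLp u 2 volume)
    (h : ∀ k : d → ℤ, ∑ j, (k j : ℂ) * mFourierCoeff (FunctionSpaces.EuclideanSpace.complexify ∘ u) k j = 0) :
    FunctionSpaces.Torus.IsWeaklyDivFree u := by
  intro θ hθ
  have hsum := FunctionSpaces.Torus.hasSum_re_inner_mFourierCoeff_complexify hu (hθ.gradient.memLp 2)
  have hzero : ∀ k : d → ℤ, (inner ℂ (mFourierCoeff (FunctionSpaces.EuclideanSpace.complexify ∘ u) k)
      (mFourierCoeff (FunctionSpaces.EuclideanSpace.complexify ∘ FunctionSpaces.Torus.gradient θ) k)).re = 0 := by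
    intro k
    have hk : inner ℂ (mFourierCoeff (FunctionSpaces.EuclideanSpace.complexify ∘ u) k)
        (mFourierCoeff (FunctionSpaces.EuclideanSpace.complexify ∘ FunctionSpaces.Torus.gradient θ) k) =
        2 * Real.pi * Complex.I * mFourierCoeff (fun x => (θ x : ℂ)) k *
          conj (∑ j, (k j : ℂ) * mFourierCoeff (FunctionSpaces.EuclideanSpace.complexify ∘ u) k j) := by
      rw [PiLp.inner_apply, map_sum, Finset.mul_sum]
      refine Finset.sum_congr rfl fun j _ => ?_
      rw [mFourierCoeff_complexify_gradient_apply hθ k j, map_mul, map_intCast]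
      simp only [RCLike.inner_apply, starRingEnd_apply]
      ring
    rw [hk, h k, map_zero, mul_zero, Complex.zero_re]
  simp_rw [hzero] at hsum
  exact (hasSum_zero.unique hsum).symm

omit [Fintype d] [DecidableEq d] in
/-- **Fatou's lemma for series** in `ℝ≥0∞`: if `g n k → gl k` for every `k`, then
`∑' k, gl k ≤ liminf_n ∑' k, g n k` (finite partial sums converge; `tsum = ⨆` of partial sums). [folklore] -/
theorem _root_.ENNReal.tsum_le_liminf_tsum {ι : Type*} {g : ℕ → ι → ℝ≥0∞} {gl : ι → ℝ≥0∞}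
    (h : ∀ k, Tendsto (fun n => g n k) atTop (𝓝 (gl k))) :
    ∑' k, gl k ≤ liminf (fun n => ∑' k, g n k) atTop := by
  rw [ENNReal.tsum_eq_iSup_sum]
  refine iSup_le fun S => ?_
  have hS : Tendsto (fun n => ∑ k ∈ S, g n k) atTop (𝓝 (∑ k ∈ S, gl k)) :=
    tendsto_finsetSum _ fun k _ => h k
  rw [← hS.liminf_eq]
  exact liminf_le_liminf (Eventually.of_forall fun n => ENNReal.sum_le_tsum S)

end Torus

section NS

variable {d : Type*} [Fintype d] [DecidableEq d]

variable {ν : ℝ} {f : ℝ → UnitAddTorus d → EuclideanSpace ℝ d}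
  {u₀ : UnitAddTorus d → EuclideanSpace ℝ d} {N : ℕ → ℕ}
  {F U : ℕ → ℝ → UnitAddTorus d → EuclideanSpace ℝ d}
  {u : ℝ → UnitAddTorus d → EuclideanSpace ℝ d}

/-! ## The limit field -/

section LimitField

/-- Measurability in time of the Galerkin coefficients: `t ↦ Û_n(t,k)` is a.e. strongly
measurable on `(0, ∞)` (it is continuous on `[0, ∞)`). [folklore] -/
theorem IsHopfGalerkinScheme.aestronglyMeasurable_mFourierCoeff
    (hS : IsHopfGalerkinScheme ν f u₀ N F U) (n : ℕ) (k : d → ℤ) :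
    AEStronglyMeasurable (fun t => mFourierCoeff (FunctionSpaces.EuclideanSpace.complexify ∘ U n t) k)
      (volume.restrict (Ioi 0)) :=
  ((FunctionSpaces.Torus.continuousOn_mFourierCoeff_of_continuousOn_stLift (hS.continuousOn n)
    k).aestronglyMeasurable measurableSet_Ici).mono_measure
      (Measure.restrict_mono Ioi_subset_Ici_self le_rfl)

/-- **The limit field of a Hopf–Galerkin scheme** (Hopf 1951, §4; Robinson–Rodrigo–Sadowski
2016, Thm. 4.4 Step 3 and proof of Thm. 4.11, Ex. 4.3–4.5; Constantin–Foias 1988, (8.14)–(8.16)).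
For `ν ≥ 0`, `u₀ ∈ L²` and `f ∈ L²ₜL²ₓ` there are a subsequence `φ` and a real field
`u : ℝ → T^d → ℝ^d`, a.e. strongly measurable on `(0, ∞) × T^d` (space–time lift), such that for
**every** `t ≥ 0` the slice `u t` is in `L²(T^d)` and every Fourier coefficient of the Galerkin
approximations converges to that of `u t`: `Û_{φ j}(t, k) → û(t, k)`. Proof: the diagonal
subsequence of `exists_subseq_tendsto_mFourierCoeff` gives limit coefficients `c t k`,
measurable in `t` (limits of continuous functions), conjugate symmetric, with
`∑_k ‖c t k‖² ≤ 2‖u₀‖² + 4T·A_T` on `[0, T]`; the field is the everywhere-in-time Riesz–Fischer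
representative `Torus.exists_realField_forall_mFourierCoeff_eq`. [cite: RobinsonRodrigoSadowski2016, Thm. 4.4 Step 3, Thm. 4.11] -/
theorem IsHopfGalerkinScheme.exists_limitField (hS : IsHopfGalerkinScheme ν f u₀ N F U)
    (hν : 0 ≤ ν) (hu₀ : MemLp u₀ 2 volume)
    (hfm : AEStronglyMeasurable (FunctionSpaces.Torus.stLift f) (volume.restrict (Ioi 0 ×ˢ univ)))
    (hf₂ : ∀ T, 0 < T → ∫⁻ t in Ioo 0 T, ∫⁻ x, ‖f t x‖ₑ ^ 2 < ⊤) :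
    ∃ φ : ℕ → ℕ, StrictMono φ ∧ ∃ u : ℝ → UnitAddTorus d → EuclideanSpace ℝ d,
      AEStronglyMeasurable (FunctionSpaces.Torus.stLift u) (volume.restrict (Ioi 0 ×ˢ univ)) ∧
      (∀ t, 0 ≤ t → MemLp (u t) 2 volume) ∧
      ∀ t, 0 ≤ t → ∀ k, Tendsto
        (fun j => mFourierCoeff (FunctionSpaces.EuclideanSpace.complexify ∘ U (φ j) t) k) atTop
        (𝓝 (mFourierCoeff (FunctionSpaces.EuclideanSpace.complexify ∘ u t) k)) := by
  obtain ⟨φ, hφ, c, hc⟩ := hS.exists_subseq_tendsto_mFourierCoeff hν hu₀ hfm hf₂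
  have hS' := hS.comp_strictMono hφ
  have hc' : ∀ t, 0 ≤ t → ∀ k, Tendsto
      (fun j => mFourierCoeff (FunctionSpaces.EuclideanSpace.complexify ∘ (U ∘ φ) j t) k) atTop (𝓝 (c t k)) :=
    hc
  -- measurability of the limit coefficients in `t`
  have hmeas : ∀ k, AEStronglyMeasurable (fun t => c t k) (volume.restrict (Ioi 0)) := by
    intro k
    refine aestronglyMeasurable_of_tendsto_ae atTop
      (fun j => hS'.aestronglyMeasurable_mFourierCoeff j k) ?_
    filter_upwards [ae_restrict_mem measurableSet_Ioi] with t ht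
    exact hc t (le_of_lt ht) k
  -- the `ℓ²` bound on `[0, T]`
  have hbound : ∀ T : ℝ, ∃ K : ℝ≥0∞, K ≠ ⊤ ∧ ∀ t ∈ Icc 0 T, ∑' k, ‖c t k‖ₑ ^ 2 ≤ K := by
    intro T
    by_cases hT : 0 < T
    · obtain ⟨A, hA, hFA⟩ := hS'.exists_force_bound hfm hf₂ hT
      refine ⟨ENNReal.ofReal (2 * (∫ x, ‖u₀ x‖ ^ 2) + 4 * T * A.toReal), ENNReal.ofReal_ne_top,
        fun t ht => ?_⟩
      rw [ENNReal.tsum_eq_iSup_sum]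
      refine iSup_le fun S => ?_
      have h := hS'.sum_norm_sq_limit_le hν hu₀ hc' hT hA hFA ht S
      calc ∑ k ∈ S, ‖c t k‖ₑ ^ 2 = ENNReal.ofReal (∑ k ∈ S, ‖c t k‖ ^ 2) := by
            rw [ENNReal.ofReal_sum_of_nonneg fun k _ => sq_nonneg _]
            refine Finset.sum_congr rfl fun k _ => ?_
            rw [← ofReal_norm, ENNReal.ofReal_pow (norm_nonneg _)]
        _ ≤ _ := ENNReal.ofReal_le_ofReal h
    · -- `[0, T] ⊆ {0}`: use the bound at time `0` on `[0, 1]`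
      obtain ⟨A, hA, hFA⟩ := hS'.exists_force_bound hfm hf₂ one_pos
      refine ⟨ENNReal.ofReal (2 * (∫ x, ‖u₀ x‖ ^ 2) + 4 * 1 * A.toReal), ENNReal.ofReal_ne_top,
        fun t ht => ?_⟩
      have ht0 : t = 0 := le_antisymm (ht.2.trans (not_lt.1 hT)) ht.1
      subst ht0
      rw [ENNReal.tsum_eq_iSup_sum]
      refine iSup_le fun S => ?_
      have h := hS'.sum_norm_sq_limit_le hν hu₀ hc' one_pos hA hFA ⟨le_rfl, zero_le_one⟩ S
      calc ∑ k ∈ S, ‖c 0 k‖ₑ ^ 2 = ENNReal.ofReal (∑ k ∈ S, ‖c 0 k‖ ^ 2) := by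
            rw [ENNReal.ofReal_sum_of_nonneg fun k _ => sq_nonneg _]
            refine Finset.sum_congr rfl fun k _ => ?_
            rw [← ofReal_norm, ENNReal.ofReal_pow (norm_nonneg _)]
        _ ≤ _ := ENNReal.ofReal_le_ofReal h
  have hsymm : ∀ t, 0 ≤ t → FunctionSpaces.Torus.IsConjSymm (c t) := fun t ht => hS'.isConjSymm_limit hc' ht
  obtain ⟨u, hum, hu⟩ := FunctionSpaces.Torus.exists_realField_forall_mFourierCoeff_eq hmeas hbound hsymm
  refine ⟨φ, hφ, u, hum, fun t ht => (hu t ht).1, fun t ht k => ?_⟩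
  rw [(hu t ht).2 k]
  exact hc t ht k

end LimitField

/-! ## Consequences of coefficientwise convergence to an `L²`-valued field

Standing hypotheses from here on: a scheme `hS`, a field `u` with `u t ∈ L²` for `t ≥ 0` (`hu`),
and `Û_n(t,k) → û(t,k)` for all `t ≥ 0`, `k` (`hc`) — as produced by `exists_limitField` for the
reindexed scheme `hS.comp_strictMono hφ`. -/

section Consequences

/-- The limit coefficients are transversal: `∑ⱼ kⱼ û(t,k)ⱼ = 0` (`t ≥ 0`). [folklore] -/
theorem IsHopfGalerkinScheme.sum_mul_mFourierCoeff_limit_eq_zero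
    (hS : IsHopfGalerkinScheme ν f u₀ N F U)
    (hc : ∀ t, 0 ≤ t → ∀ k, Tendsto (fun n => mFourierCoeff (FunctionSpaces.EuclideanSpace.complexify ∘ U n t) k)
      atTop (𝓝 (mFourierCoeff (FunctionSpaces.EuclideanSpace.complexify ∘ u t) k))) {t : ℝ} (ht : 0 ≤ t)
    (k : d → ℤ) :
    ∑ j, (k j : ℂ) * mFourierCoeff (FunctionSpaces.EuclideanSpace.complexify ∘ u t) k j = 0 :=
  hS.sum_mul_limit_eq_zero (c := fun t k => mFourierCoeff (FunctionSpaces.EuclideanSpace.complexify ∘ u t) k)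
    hc ht k

/-- **Every slice of the limit is weakly divergence free** (`t ≥ 0`; transversal coefficients,
`Torus.isWeaklyDivFree_of_sum_mul_mFourierCoeff_eq_zero`, RRS Lemma 2.3). [cite: RobinsonRodrigoSadowski2016, Lemma 2.3] -/
theorem IsHopfGalerkinScheme.isWeaklyDivFree_limit (hS : IsHopfGalerkinScheme ν f u₀ N F U)
    (hu : ∀ t, 0 ≤ t → MemLp (u t) 2 volume)
    (hc : ∀ t, 0 ≤ t → ∀ k, Tendsto (fun n => mFourierCoeff (FunctionSpaces.EuclideanSpace.complexify ∘ U n t) k)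
      atTop (𝓝 (mFourierCoeff (FunctionSpaces.EuclideanSpace.complexify ∘ u t) k))) {t : ℝ} (ht : 0 ≤ t) :
    FunctionSpaces.Torus.IsWeaklyDivFree (u t) :=
  Torus.isWeaklyDivFree_of_sum_mul_mFourierCoeff_eq_zero (hu t ht)
    (hS.sum_mul_mFourierCoeff_limit_eq_zero hc ht)

/-- The limit has the Fourier coefficients of the datum at time `0`: `û(0, k) = û₀(k)`. [folklore] -/
theorem IsHopfGalerkinScheme.mFourierCoeff_limit_zero (hS : IsHopfGalerkinScheme ν f u₀ N F U)
    (hu₀ : MemLp u₀ 2 volume) (hdiv : FunctionSpaces.Torus.IsWeaklyDivFree u₀)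
    (hc : ∀ t, 0 ≤ t → ∀ k, Tendsto (fun n => mFourierCoeff (FunctionSpaces.EuclideanSpace.complexify ∘ U n t) k)
      atTop (𝓝 (mFourierCoeff (FunctionSpaces.EuclideanSpace.complexify ∘ u t) k))) (k : d → ℤ) :
    mFourierCoeff (FunctionSpaces.EuclideanSpace.complexify ∘ u 0) k =
      mFourierCoeff (FunctionSpaces.EuclideanSpace.complexify ∘ u₀) k :=
  hS.limit_zero_eq (c := fun t k => mFourierCoeff (FunctionSpaces.EuclideanSpace.complexify ∘ u t) k) hu₀ hdiv hc k

omit [DecidableEq d] in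
/-- **Fourier uniqueness in `L²(T^d; ℝ^d)`**: two `L²` real vector fields with the same Fourier
coefficients (of their complexifications) agree a.e. (Parseval applied to the difference;
Grafakos 2014, Prop. 3.2.7). [cite: Grafakos2014, Prop. 3.2.7] -/
theorem Torus.ae_eq_of_mFourierCoeff_complexify_eq
    {v w : UnitAddTorus d → EuclideanSpace ℝ d} (hv : MemLp v 2 volume) (hw : MemLp w 2 volume)
    (h : ∀ k, mFourierCoeff (FunctionSpaces.EuclideanSpace.complexify ∘ v) k =
      mFourierCoeff (FunctionSpaces.EuclideanSpace.complexify ∘ w) k) :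
    v =ᵐ[volume] w := by
  have hvw : MemLp (v - w) 2 volume := hv.sub hw
  have hcoef : ∀ k, mFourierCoeff (FunctionSpaces.EuclideanSpace.complexify ∘ (v - w)) k = 0 := by
    intro k
    have hsplit : FunctionSpaces.EuclideanSpace.complexify ∘ (v - w) =
        FunctionSpaces.EuclideanSpace.complexify ∘ v - FunctionSpaces.EuclideanSpace.complexify ∘ w := by
      funext x
      simp [map_sub]
    rw [hsplit, FunctionSpaces.Torus.mFourierCoeff_eq_integral_volume]
    have hφ : MemLp (fun x : UnitAddTorus d => mFourier (-k) x) ∞ volume :=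
      memLp_top_of_bound (mFourier (-k)).continuous.aestronglyMeasurable 1
        (Eventually.of_forall fun x => ((mFourier (-k)).norm_coe_le_norm x).trans_eq mFourier_norm)
    have hiv : Integrable (fun x => mFourier (-k) x • (FunctionSpaces.EuclideanSpace.complexify ∘ v) x) volume :=
      (FunctionSpaces.Torus.integrable_complexify_comp (hv.integrable one_le_two)).smul_of_top_right hφ
    have hiw : Integrable (fun x => mFourier (-k) x • (FunctionSpaces.EuclideanSpace.complexify ∘ w) x) volume :=
      (FunctionSpaces.Torus.integrable_complexify_comp (hw.integrable one_le_two)).smul_of_top_right hφ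
    simp only [Pi.sub_apply, smul_sub]
    rw [integral_sub hiv hiw, ← FunctionSpaces.Torus.mFourierCoeff_eq_integral_volume, ← FunctionSpaces.Torus.mFourierCoeff_eq_integral_volume,
      h k, sub_self]
  have hpar := FunctionSpaces.Torus.hasSum_sq_norm_mFourierCoeff_complexify hvw
  simp_rw [hcoef, norm_zero, zero_pow two_ne_zero] at hpar
  have h0 : ∫ x, ‖(v - w) x‖ ^ 2 = 0 := (hasSum_zero.unique hpar).symm
  have hnn : 0 ≤ᵐ[volume] fun x => ‖(v - w) x‖ ^ 2 := ae_of_all _ fun x => sq_nonneg _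
  have hae := (integral_eq_zero_iff_of_nonneg_ae hnn (hvw.integrable_norm_pow two_ne_zero)).1 h0
  filter_upwards [hae] with x hx
  have : ‖(v - w) x‖ = 0 := pow_eq_zero_iff two_ne_zero |>.1 hx
  simpa [sub_eq_zero] using this

/-- **The limit attains the datum at time `0`, a.e.**: `u 0 = u₀` almost everywhere. [folklore] -/
theorem IsHopfGalerkinScheme.limit_zero_ae_eq (hS : IsHopfGalerkinScheme ν f u₀ N F U)
    (hu₀ : MemLp u₀ 2 volume) (hdiv : FunctionSpaces.Torus.IsWeaklyDivFree u₀)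
    (hu : ∀ t, 0 ≤ t → MemLp (u t) 2 volume)
    (hc : ∀ t, 0 ≤ t → ∀ k, Tendsto (fun n => mFourierCoeff (FunctionSpaces.EuclideanSpace.complexify ∘ U n t) k)
      atTop (𝓝 (mFourierCoeff (FunctionSpaces.EuclideanSpace.complexify ∘ u t) k))) :
    u 0 =ᵐ[volume] u₀ :=
  Torus.ae_eq_of_mFourierCoeff_complexify_eq (hu 0 le_rfl) hu₀ (hS.mFourierCoeff_limit_zero hu₀ hdiv hc)

/-- `E(u 0) = E(u₀)` for the limit field. [folklore] -/
theorem IsHopfGalerkinScheme.kineticEnergy_limit_zero (hS : IsHopfGalerkinScheme ν f u₀ N F U)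
    (hu₀ : MemLp u₀ 2 volume) (hdiv : FunctionSpaces.Torus.IsWeaklyDivFree u₀)
    (hu : ∀ t, 0 ≤ t → MemLp (u t) 2 volume)
    (hc : ∀ t, 0 ≤ t → ∀ k, Tendsto (fun n => mFourierCoeff (FunctionSpaces.EuclideanSpace.complexify ∘ U n t) k)
      atTop (𝓝 (mFourierCoeff (FunctionSpaces.EuclideanSpace.complexify ∘ u t) k))) :
    FunctionSpaces.Torus.kineticEnergy (u 0) = FunctionSpaces.Torus.kineticEnergy u₀ := by
  unfold FunctionSpaces.Torus.kineticEnergy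
  congr 1
  refine integral_congr_ae ?_
  filter_upwards [hS.limit_zero_ae_eq hu₀ hdiv hu hc] with x hx
  rw [hx]

/-- The limit coefficients are continuous in time on `[0, ∞)`. [folklore] -/
theorem IsHopfGalerkinScheme.continuousOn_mFourierCoeff_limit
    (hS : IsHopfGalerkinScheme ν f u₀ N F U) (hν : 0 ≤ ν) (hu₀ : MemLp u₀ 2 volume)
    (hfm : AEStronglyMeasurable (FunctionSpaces.Torus.stLift f) (volume.restrict (Ioi 0 ×ˢ univ)))
    (hf₂ : ∀ T, 0 < T → ∫⁻ t in Ioo 0 T, ∫⁻ x, ‖f t x‖ₑ ^ 2 < ⊤)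
    (hc : ∀ t, 0 ≤ t → ∀ k, Tendsto (fun n => mFourierCoeff (FunctionSpaces.EuclideanSpace.complexify ∘ U n t) k)
      atTop (𝓝 (mFourierCoeff (FunctionSpaces.EuclideanSpace.complexify ∘ u t) k))) (k : d → ℤ) :
    ContinuousOn (fun t => mFourierCoeff (FunctionSpaces.EuclideanSpace.complexify ∘ u t) k) (Ici 0) :=
  hS.continuousOn_limit (c := fun t k => mFourierCoeff (FunctionSpaces.EuclideanSpace.complexify ∘ u t) k)
    hν hu₀ hfm hf₂ hc k

/-- **Uniform `L²` bound of the limit** (Robinson–Rodrigo–Sadowski 2016, (4.10): the limit is in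
`L^∞(0,T; L²)` with the bound of the approximations; Constantin–Foias 1988, (8.12)): for
`t ∈ [0, T]`, `∫ ‖u t‖² ≤ 2∫‖u₀‖² + 4T·A` where `A` bounds `∫₀ᵀ‖F n‖²`. [cite: RobinsonRodrigoSadowski2016, Thm. 4.4 Step 3 (4.10)] -/
theorem IsHopfGalerkinScheme.integral_norm_sq_limit_le (hS : IsHopfGalerkinScheme ν f u₀ N F U)
    (hν : 0 ≤ ν) (hu₀ : MemLp u₀ 2 volume) (hu : ∀ t, 0 ≤ t → MemLp (u t) 2 volume)
    (hc : ∀ t, 0 ≤ t → ∀ k, Tendsto (fun n => mFourierCoeff (FunctionSpaces.EuclideanSpace.complexify ∘ U n t) k)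
      atTop (𝓝 (mFourierCoeff (FunctionSpaces.EuclideanSpace.complexify ∘ u t) k))) {T : ℝ} (hT : 0 < T)
    {A : ℝ≥0∞} (hA : A ≠ ⊤) (hFA : ∀ n, ∫⁻ τ in Ioo 0 T, ∫⁻ x, ‖F n τ x‖ₑ ^ 2 ≤ A) {t : ℝ}
    (ht : t ∈ Icc 0 T) :
    ∫ x, ‖u t x‖ ^ 2 ≤ 2 * (∫ x, ‖u₀ x‖ ^ 2) + 4 * T * A.toReal := by
  exact hasSum_le_of_sum_le (FunctionSpaces.Torus.hasSum_sq_norm_mFourierCoeff_complexify (hu t ht.1))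
    fun S => hS.sum_norm_sq_limit_le
      (c := fun t k => mFourierCoeff (FunctionSpaces.EuclideanSpace.complexify ∘ u t) k) hν hu₀ hc hT hA hFA ht S

end Consequences

/-! ## Fatou for the dissipation -/

section Dissipation

omit [DecidableEq d] in
/-- Measurability in time of the spectral gradient norm of a field whose Fourier coefficients
are a.e. strongly measurable in time (`eGradNormSq = 4π² ∑ₖ |k|² ‖·̂(k)‖ₑ²`, a countable sum). [folklore] -/
theorem Torus.aemeasurable_eGradNormSq_of_coeff {μ : Measure ℝ}
    {w : ℝ → UnitAddTorus d → EuclideanSpace ℝ d}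
    (hw : ∀ k, AEStronglyMeasurable (fun t => mFourierCoeff (FunctionSpaces.EuclideanSpace.complexify ∘ w t) k) μ) :
    AEMeasurable (fun t => FunctionSpaces.Torus.eGradNormSq (w t)) μ := by
  have h : (fun t => FunctionSpaces.Torus.eGradNormSq (w t)) = fun t => ENNReal.ofReal (4 * Real.pi ^ 2) *
      ∑' k : d → ℤ, ENNReal.ofReal (FunctionSpaces.Torus.freqNormSq k) *
        ‖mFourierCoeff (FunctionSpaces.EuclideanSpace.complexify ∘ w t) k‖ₑ ^ 2 :=
    funext fun t => FunctionSpaces.Torus.eGradNormSq_eq_tsum (w t)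
  rw [h]
  exact (AEMeasurable.tsum fun k => ((hw k).enorm.pow_const 2).const_mul _).const_mul _

omit [DecidableEq d] in
/-- Measurability in time of `∫⁻ ‖w t‖ₑ²` for a family with `L²` slices on the set of times of
interest and measurable coefficients (Parseval, countable sum). [folklore] -/
theorem Torus.aemeasurable_lintegral_enorm_sq_of_coeff {S : Set ℝ}
    (hSm : MeasurableSet S) {w : ℝ → UnitAddTorus d → EuclideanSpace ℝ d}
    (hmem : ∀ t ∈ S, MemLp (w t) 2 volume)
    (hw : ∀ k, AEStronglyMeasurable (fun t => mFourierCoeff (FunctionSpaces.EuclideanSpace.complexify ∘ w t) k)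
      (volume.restrict S)) :
    AEMeasurable (fun t => ∫⁻ x, ‖w t x‖ₑ ^ 2) (volume.restrict S) := by
  have h : AEMeasurable (fun t => ∑' k : d → ℤ,
      ‖mFourierCoeff (FunctionSpaces.EuclideanSpace.complexify ∘ w t) k‖ₑ ^ 2) (volume.restrict S) :=
    AEMeasurable.tsum fun k => (hw k).enorm.pow_const 2
  refine h.congr ?_
  filter_upwards [ae_restrict_mem hSm] with t ht
  exact FunctionSpaces.Torus.tsum_enorm_sq_mFourierCoeff_complexify (hmem t ht)

/-- Measurability in time of `t ↦ ‖∇U n(t)‖²` on `(0, T)`. [folklore] -/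
theorem IsHopfGalerkinScheme.aemeasurable_eGradNormSq (hS : IsHopfGalerkinScheme ν f u₀ N F U)
    (n : ℕ) (T : ℝ) :
    AEMeasurable (fun t => FunctionSpaces.Torus.eGradNormSq (U n t)) (volume.restrict (Ioo 0 T)) :=
  Torus.aemeasurable_eGradNormSq_of_coeff fun k =>
    (hS.aestronglyMeasurable_mFourierCoeff n k).mono_measure
      (Measure.restrict_mono Ioo_subset_Ioi_self le_rfl)

/-- The dissipation integral of a Galerkin approximation over `(0, T)` is finite (the slices are
band-limited with coefficients bounded by the continuous `t ↦ ∫ ‖U n t‖²`). [folklore] -/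
theorem IsHopfGalerkinScheme.lintegral_eGradNormSq_lt_top (hS : IsHopfGalerkinScheme ν f u₀ N F U)
    (n : ℕ) (T : ℝ) :
    ∫⁻ t in Ioo 0 T, FunctionSpaces.Torus.eGradNormSq (U n t) < ⊤ := by
  -- a bound for `∫ ‖U n t‖²` on `[0, T]`
  obtain ⟨M, hM⟩ := (isCompact_Icc (a := (0 : ℝ)) (b := T)).exists_bound_of_continuousOn
    ((FunctionSpaces.Torus.continuousOn_integral_norm_sq_of_continuousOn_stLift (hS.continuousOn n)).mono
      fun t ht => mem_Ici.2 ht.1)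
  set C : ℝ := 4 * Real.pi ^ 2 * ∑ k ∈ FunctionSpaces.Torus.freqBall (d := d) (N n), FunctionSpaces.Torus.freqNormSq k * M with hC
  have hbound : ∀ t ∈ Ioo 0 T, FunctionSpaces.Torus.eGradNormSq (U n t) ≤ ENNReal.ofReal C := by
    intro t ht
    have ht0 : 0 ≤ t := ht.1.le
    rw [FunctionSpaces.Torus.eGradNormSq_eq_sum_of_band_limited (hS.continuous_slice n ht0)
      (hS.isGalerkinMode n t ht0).2.2]
    refine ENNReal.ofReal_le_ofReal (mul_le_mul_of_nonneg_left (Finset.sum_le_sum fun k _ => ?_)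
      (by positivity))
    refine mul_le_mul_of_nonneg_left ?_ (FunctionSpaces.Torus.freqNormSq_nonneg k)
    refine (hS.norm_mFourierCoeff_sq_le n ht0 k).trans ?_
    have h := hM t ⟨ht0, ht.2.le⟩
    rw [Real.norm_eq_abs] at h
    exact (le_abs_self _).trans h
  calc ∫⁻ t in Ioo 0 T, FunctionSpaces.Torus.eGradNormSq (U n t)
      ≤ ∫⁻ _ in Ioo 0 T, ENNReal.ofReal C := setLIntegral_mono' measurableSet_Ioo hbound
    _ < ⊤ := by
        rw [setLIntegral_const]
        exact ENNReal.mul_lt_top ENNReal.ofReal_lt_top measure_Ioo_lt_top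

/-- **Uniform dissipation bound, extended form** (Robinson–Rodrigo–Sadowski 2016, (4.9);
Constantin–Foias 1988, (8.13)): for `ν > 0`,
`∫⁻_{(0,T)} ‖∇U n‖² ≤ ((∫ ‖u₀‖²) + 2TA)/ν` in `ℝ≥0∞`. [cite: RobinsonRodrigoSadowski2016, Thm. 4.4 Step 3 (4.9)] -/
theorem IsHopfGalerkinScheme.lintegral_eGradNormSq_le (hS : IsHopfGalerkinScheme ν f u₀ N F U)
    (hν : 0 < ν) (hu₀ : MemLp u₀ 2 volume) {T : ℝ} (hT : 0 < T) {A : ℝ≥0∞} (hA : A ≠ ⊤) (n : ℕ)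
    (hFA : ∫⁻ τ in Ioo 0 T, ∫⁻ x, ‖F n τ x‖ₑ ^ 2 ≤ A) :
    ∫⁻ t in Ioo 0 T, FunctionSpaces.Torus.eGradNormSq (U n t) ≤
      ENNReal.ofReal (((∫ x, ‖u₀ x‖ ^ 2) + 2 * T * A.toReal) / ν) := by
  have hfin := (hS.lintegral_eGradNormSq_lt_top n T).ne
  have h1 := hS.dissipation_le hν.le hT hA n hFA
  have h2 := hS.integral_norm_sq_zero_le hu₀ n
  rw [← ENNReal.ofReal_toReal hfin]
  refine ENNReal.ofReal_le_ofReal ?_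
  rw [le_div_iff₀ hν, mul_comm]
  linarith

omit [DecidableEq d] in
/-- **Fatou for the dissipation, slicewise**: `‖∇u(t)‖² ≤ liminf_n ‖∇U n(t)‖²` for `t ≥ 0`
(every Fourier coefficient converges; Fatou for the series `4π² ∑ |k|² ‖·‖²`;
Robinson–Rodrigo–Sadowski 2016, (4.11): the `L²ₜH¹ₓ` bound passes to the weak limit). [cite: RobinsonRodrigoSadowski2016, Thm. 4.4 Step 3 (4.11)] -/
theorem eGradNormSq_le_liminf_of_tendsto_mFourierCoeff
    (hc : ∀ t, 0 ≤ t → ∀ k, Tendsto (fun n => mFourierCoeff (FunctionSpaces.EuclideanSpace.complexify ∘ U n t) k)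
      atTop (𝓝 (mFourierCoeff (FunctionSpaces.EuclideanSpace.complexify ∘ u t) k))) {t : ℝ} (ht : 0 ≤ t) :
    FunctionSpaces.Torus.eGradNormSq (u t) ≤ liminf (fun n => FunctionSpaces.Torus.eGradNormSq (U n t)) atTop := by
  have h : ∀ v : UnitAddTorus d → EuclideanSpace ℝ d, FunctionSpaces.Torus.eGradNormSq v =
      ∑' k : d → ℤ, ENNReal.ofReal (4 * Real.pi ^ 2) * (ENNReal.ofReal (FunctionSpaces.Torus.freqNormSq k) *
        ‖mFourierCoeff (FunctionSpaces.EuclideanSpace.complexify ∘ v) k‖ₑ ^ 2) := fun v => by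
    rw [FunctionSpaces.Torus.eGradNormSq_eq_tsum, ENNReal.tsum_mul_left]
  simp_rw [h]
  refine ENNReal.tsum_le_liminf_tsum fun k => ?_
  refine ENNReal.Tendsto.const_mul ?_ (Or.inr ENNReal.ofReal_ne_top)
  refine ENNReal.Tendsto.const_mul ?_ (Or.inr ENNReal.ofReal_ne_top)
  exact ((ENNReal.continuous_pow 2).tendsto _).comp (hc t ht k).enorm

/-- **The limit dissipates no more than the approximations** (Robinson–Rodrigo–Sadowski 2016,
(4.11); Constantin–Foias 1988, (8.13)): for `ν > 0`,
`∫⁻_{(0,T)} ‖∇u‖² ≤ ((∫ ‖u₀‖²) + 2TA)/ν`, by Fatou in `t` on top of `eGradNormSq_le_liminf_of_tendsto_mFourierCoeff`.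
In particular `u ∈ L²(0, T; H¹)`. [cite: RobinsonRodrigoSadowski2016, Thm. 4.4 Step 3 (4.11)] -/
theorem IsHopfGalerkinScheme.lintegral_eGradNormSq_limit_le
    (hS : IsHopfGalerkinScheme ν f u₀ N F U) (hν : 0 < ν) (hu₀ : MemLp u₀ 2 volume)
    (hc : ∀ t, 0 ≤ t → ∀ k, Tendsto (fun n => mFourierCoeff (FunctionSpaces.EuclideanSpace.complexify ∘ U n t) k)
      atTop (𝓝 (mFourierCoeff (FunctionSpaces.EuclideanSpace.complexify ∘ u t) k))) {T : ℝ} (hT : 0 < T)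
    {A : ℝ≥0∞} (hA : A ≠ ⊤) (hFA : ∀ n, ∫⁻ τ in Ioo 0 T, ∫⁻ x, ‖F n τ x‖ₑ ^ 2 ≤ A) :
    ∫⁻ t in Ioo 0 T, FunctionSpaces.Torus.eGradNormSq (u t) ≤
      ENNReal.ofReal (((∫ x, ‖u₀ x‖ ^ 2) + 2 * T * A.toReal) / ν) :=
  calc ∫⁻ t in Ioo 0 T, FunctionSpaces.Torus.eGradNormSq (u t)
      ≤ ∫⁻ t in Ioo 0 T, liminf (fun n => FunctionSpaces.Torus.eGradNormSq (U n t)) atTop :=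
        setLIntegral_mono' measurableSet_Ioo fun _ ht =>
          eGradNormSq_le_liminf_of_tendsto_mFourierCoeff hc ht.1.le
    _ ≤ liminf (fun n => ∫⁻ t in Ioo 0 T, FunctionSpaces.Torus.eGradNormSq (U n t)) atTop :=
        lintegral_liminf_le' fun n => hS.aemeasurable_eGradNormSq n T
    _ ≤ ENNReal.ofReal (((∫ x, ‖u₀ x‖ ^ 2) + 2 * T * A.toReal) / ν) :=
        liminf_le_of_frequently_le'
          (Eventually.of_forall fun n => hS.lintegral_eGradNormSq_le hν hu₀ hT hA n (hFA n)).frequently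

/-- The dissipation integral of the limit over `(0, T)` is finite (`ν > 0`). [folklore] -/
theorem IsHopfGalerkinScheme.lintegral_eGradNormSq_limit_lt_top
    (hS : IsHopfGalerkinScheme ν f u₀ N F U) (hν : 0 < ν) (hu₀ : MemLp u₀ 2 volume)
    (hfm : AEStronglyMeasurable (FunctionSpaces.Torus.stLift f) (volume.restrict (Ioi 0 ×ˢ univ)))
    (hf₂ : ∀ T, 0 < T → ∫⁻ t in Ioo 0 T, ∫⁻ x, ‖f t x‖ₑ ^ 2 < ⊤)
    (hc : ∀ t, 0 ≤ t → ∀ k, Tendsto (fun n => mFourierCoeff (FunctionSpaces.EuclideanSpace.complexify ∘ U n t) k)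
      atTop (𝓝 (mFourierCoeff (FunctionSpaces.EuclideanSpace.complexify ∘ u t) k))) {T : ℝ} (hT : 0 < T) :
    ∫⁻ t in Ioo 0 T, FunctionSpaces.Torus.eGradNormSq (u t) < ⊤ := by
  obtain ⟨A, hA, hFA⟩ := hS.exists_force_bound hfm hf₂ hT
  exact lt_of_le_of_lt (hS.lintegral_eGradNormSq_limit_le hν hu₀ hc hT hA hFA) ENNReal.ofReal_lt_top

end Dissipation

/-! ## Friedrichs' inequality: strong convergence in `L²((0,T) × T^d)` -/

section Friedrichs

omit [Fintype d] [DecidableEq d] in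
/-- `‖a - b‖ₑ² ≤ 2‖a‖ₑ² + 2‖b‖ₑ²`. [folklore] -/
theorem enorm_sub_sq_le_two_mul {E : Type*} [NormedAddCommGroup E] (a b : E) :
    ‖a - b‖ₑ ^ 2 ≤ 2 * ‖a‖ₑ ^ 2 + 2 * ‖b‖ₑ ^ 2 := by
  have h := enorm_sq_le_two_mul_add (a - b) a
  rwa [sub_sub_cancel_left, enorm_neg, add_comm] at h

omit [DecidableEq d] in
/-- Fourier coefficients of a difference of integrable real fields. [folklore] -/
theorem Torus.mFourierCoeff_complexify_sub {v w : UnitAddTorus d → EuclideanSpace ℝ d}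
    (hv : Integrable v volume) (hw : Integrable w volume) (k : d → ℤ) :
    mFourierCoeff (FunctionSpaces.EuclideanSpace.complexify ∘ (v - w)) k =
      mFourierCoeff (FunctionSpaces.EuclideanSpace.complexify ∘ v) k -
        mFourierCoeff (FunctionSpaces.EuclideanSpace.complexify ∘ w) k := by
  have hsplit : FunctionSpaces.EuclideanSpace.complexify ∘ (v - w) =
      FunctionSpaces.EuclideanSpace.complexify ∘ v - FunctionSpaces.EuclideanSpace.complexify ∘ w := by
    funext x
    simp [map_sub]
  have hφ : MemLp (fun x : UnitAddTorus d => mFourier (-k) x) ∞ volume :=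
    memLp_top_of_bound (mFourier (-k)).continuous.aestronglyMeasurable 1
      (Eventually.of_forall fun x => ((mFourier (-k)).norm_coe_le_norm x).trans_eq mFourier_norm)
  have hiv : Integrable (fun x => mFourier (-k) x • (FunctionSpaces.EuclideanSpace.complexify ∘ v) x) volume :=
    (FunctionSpaces.Torus.integrable_complexify_comp hv).smul_of_top_right hφ
  have hiw : Integrable (fun x => mFourier (-k) x • (FunctionSpaces.EuclideanSpace.complexify ∘ w) x) volume :=
    (FunctionSpaces.Torus.integrable_complexify_comp hw).smul_of_top_right hφ
  rw [hsplit, FunctionSpaces.Torus.mFourierCoeff_eq_integral_volume, FunctionSpaces.Torus.mFourierCoeff_eq_integral_volume,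
    FunctionSpaces.Torus.mFourierCoeff_eq_integral_volume]
  simp only [Pi.sub_apply, smul_sub]
  exact integral_sub hiv hiw

/-- **High-frequency tail bound, pointwise** ("Friedrichs' inequality" on the Fourier side;
Robinson–Rodrigo–Sadowski 2016, proof of Thm. 4.11 and Ex. 4.8; Hopf 1951, §4): for coefficient
families `a`, `b`, a finite frequency set containing the ball `|k| ≤ R` (`R ≥ 1`) and every `k`,
`‖a k - b k‖ₑ² ≤ 𝟙_S(k) ‖a k - b k‖ₑ² + R⁻² |k|² (2‖a k‖ₑ² + 2‖b k‖ₑ²)`. [cite: RobinsonRodrigoSadowski2016, Thm. 4.11 (proof)] -/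
theorem Torus.enorm_sub_sq_le_indicator_add (a b : (d → ℤ) → EuclideanSpace ℂ d) {R : ℕ}
    (hR : 1 ≤ R) (k : d → ℤ) :
    ‖a k - b k‖ₑ ^ 2 ≤
      Set.indicator ((FunctionSpaces.Torus.freqBall (d := d) R : Finset (d → ℤ)) : Set (d → ℤ)) (fun k => ‖a k - b k‖ₑ ^ 2) k +
        ENNReal.ofReal (1 / (R : ℝ) ^ 2) * (ENNReal.ofReal (FunctionSpaces.Torus.freqNormSq k) *
          (2 * ‖a k‖ₑ ^ 2 + 2 * ‖b k‖ₑ ^ 2)) := by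
  by_cases hk : k ∈ FunctionSpaces.Torus.freqBall R
  · rw [Set.indicator_of_mem (Finset.mem_coe.2 hk)]
    exact le_self_add
  · rw [Set.indicator_of_notMem (fun h => hk (Finset.mem_coe.1 h)), zero_add]
    have hR0 : (0 : ℝ) < (R : ℝ) ^ 2 := by
      have : (1 : ℝ) ≤ R := by exact_mod_cast hR
      positivity
    have hk' : (R : ℝ) ^ 2 < FunctionSpaces.Torus.freqNormSq k := FunctionSpaces.Torus.not_mem_freqBall.1 hk
    have hone : 1 ≤ ENNReal.ofReal (1 / (R : ℝ) ^ 2) * ENNReal.ofReal (FunctionSpaces.Torus.freqNormSq k) := by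
      rw [← ENNReal.ofReal_mul (by positivity), ← ENNReal.ofReal_one]
      refine ENNReal.ofReal_le_ofReal ?_
      rw [one_div, inv_mul_eq_div, le_div_iff₀ hR0, one_mul]
      exact hk'.le
    calc ‖a k - b k‖ₑ ^ 2 ≤ 2 * ‖a k‖ₑ ^ 2 + 2 * ‖b k‖ₑ ^ 2 := enorm_sub_sq_le_two_mul _ _
      _ = 1 * (2 * ‖a k‖ₑ ^ 2 + 2 * ‖b k‖ₑ ^ 2) := (one_mul _).symm
      _ ≤ (ENNReal.ofReal (1 / (R : ℝ) ^ 2) * ENNReal.ofReal (FunctionSpaces.Torus.freqNormSq k)) *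
            (2 * ‖a k‖ₑ ^ 2 + 2 * ‖b k‖ₑ ^ 2) := by gcongr
      _ = _ := by rw [mul_assoc]

/-- **Parseval split of the `L²` distance of two real fields** into the frequency ball `|k| ≤ R`
and the tail, the tail controlled by the spectral gradient norms:
`∫⁻ ‖v - w‖ₑ² ≤ ∑_{|k|≤R} ‖v̂ k - ŵ k‖ₑ² + (2/(4π²R²)) (‖∇v‖² + ‖∇w‖²)` for `v, w ∈ L²`, `R ≥ 1`
(Robinson–Rodrigo–Sadowski 2016, proof of Thm. 4.11; Hopf 1951, §4). [cite: RobinsonRodrigoSadowski2016, Thm. 4.11 (proof)] -/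
theorem Torus.lintegral_enorm_sub_sq_le_sum_add
    {v w : UnitAddTorus d → EuclideanSpace ℝ d} (hv : MemLp v 2 volume) (hw : MemLp w 2 volume)
    {R : ℕ} (hR : 1 ≤ R) :
    ∫⁻ x, ‖v x - w x‖ₑ ^ 2 ≤
      (∑ k ∈ FunctionSpaces.Torus.freqBall R, ‖mFourierCoeff (FunctionSpaces.EuclideanSpace.complexify ∘ v) k -
          mFourierCoeff (FunctionSpaces.EuclideanSpace.complexify ∘ w) k‖ₑ ^ 2) +
        ENNReal.ofReal (2 / (4 * Real.pi ^ 2 * (R : ℝ) ^ 2)) *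
          (FunctionSpaces.Torus.eGradNormSq v + FunctionSpaces.Torus.eGradNormSq w) := by
  have hvw : MemLp (v - w) 2 volume := hv.sub hw
  have hpar := FunctionSpaces.Torus.tsum_enorm_sq_mFourierCoeff_complexify hvw
  have hcoef : ∀ k, mFourierCoeff (FunctionSpaces.EuclideanSpace.complexify ∘ (v - w)) k =
      mFourierCoeff (FunctionSpaces.EuclideanSpace.complexify ∘ v) k -
        mFourierCoeff (FunctionSpaces.EuclideanSpace.complexify ∘ w) k :=
    Torus.mFourierCoeff_complexify_sub (hv.integrable one_le_two) (hw.integrable one_le_two)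
  have hlhs : ∫⁻ x, ‖v x - w x‖ₑ ^ 2 = ∫⁻ x, ‖(v - w) x‖ₑ ^ 2 := rfl
  rw [hlhs, ← hpar]
  simp_rw [hcoef]
  set a := fun k => mFourierCoeff (FunctionSpaces.EuclideanSpace.complexify ∘ v) k with ha
  set b := fun k => mFourierCoeff (FunctionSpaces.EuclideanSpace.complexify ∘ w) k with hb
  -- the spectral sums `G a = ∑ |k|² ‖a k‖ₑ²`, `eGradNormSq v = 4π² G a`
  set Ga : ℝ≥0∞ := ∑' k : d → ℤ, ENNReal.ofReal (FunctionSpaces.Torus.freqNormSq k) * ‖a k‖ₑ ^ 2 with hGa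
  set Gb : ℝ≥0∞ := ∑' k : d → ℤ, ENNReal.ofReal (FunctionSpaces.Torus.freqNormSq k) * ‖b k‖ₑ ^ 2 with hGb
  have hGv : FunctionSpaces.Torus.eGradNormSq v = ENNReal.ofReal (4 * Real.pi ^ 2) * Ga := FunctionSpaces.Torus.eGradNormSq_eq_tsum v
  have hGw : FunctionSpaces.Torus.eGradNormSq w = ENNReal.ofReal (4 * Real.pi ^ 2) * Gb := FunctionSpaces.Torus.eGradNormSq_eq_tsum w
  calc ∑' k, ‖a k - b k‖ₑ ^ 2
      ≤ ∑' k, (Set.indicator ((FunctionSpaces.Torus.freqBall (d := d) R : Finset (d → ℤ)) : Set (d → ℤ)) (fun k => ‖a k - b k‖ₑ ^ 2) k +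
          ENNReal.ofReal (1 / (R : ℝ) ^ 2) * (ENNReal.ofReal (FunctionSpaces.Torus.freqNormSq k) *
            (2 * ‖a k‖ₑ ^ 2 + 2 * ‖b k‖ₑ ^ 2))) :=
        ENNReal.tsum_le_tsum fun k => Torus.enorm_sub_sq_le_indicator_add a b hR k
    _ = (∑ k ∈ FunctionSpaces.Torus.freqBall R, ‖a k - b k‖ₑ ^ 2) +
          ENNReal.ofReal (1 / (R : ℝ) ^ 2) * (2 * Ga + 2 * Gb) := by
        rw [ENNReal.tsum_add, ← sum_eq_tsum_indicator, ENNReal.tsum_mul_left]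
        congr 2
        simp_rw [mul_add]
        rw [ENNReal.tsum_add]
        congr 1
        · rw [hGa, ← ENNReal.tsum_mul_left]
          exact tsum_congr fun k => by ring
        · rw [hGb, ← ENNReal.tsum_mul_left]
          exact tsum_congr fun k => by ring
    _ = (∑ k ∈ FunctionSpaces.Torus.freqBall R, ‖a k - b k‖ₑ ^ 2) +
          ENNReal.ofReal (2 / (4 * Real.pi ^ 2 * (R : ℝ) ^ 2)) *
            (FunctionSpaces.Torus.eGradNormSq v + FunctionSpaces.Torus.eGradNormSq w) := by
        rw [hGv, hGw]
        congr 1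
        rw [← mul_add, ← mul_add, ← mul_assoc, ← ENNReal.ofReal_ofNat,
          ← ENNReal.ofReal_mul (by positivity), ← mul_assoc, ← ENNReal.ofReal_mul (by positivity)]
        congr 2
        have hπ : (4 : ℝ) * Real.pi ^ 2 ≠ 0 := by positivity
        have hR0 : (R : ℝ) ^ 2 ≠ 0 := by
          have : (1 : ℝ) ≤ R := by exact_mod_cast hR
          positivity
        field_simp

/-- **Friedrichs / Aubin–Lions on the Fourier side: strong convergence in `L²((0,T) × T^d)`**
(Hopf 1951, §4; Robinson–Rodrigo–Sadowski 2016, Thm. 4.4 Step 3 (4.13) via Thm. 4.11 and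
Ex. 4.8–4.9; Constantin–Foias 1988, Lemma 8.4 and (8.16)). For `ν > 0`: if every Fourier
coefficient of the Galerkin approximations converges at every time `t ≥ 0` to that of a field
`u` with `L²` slices, then `∫₀ᵀ ∫ ‖U n - u‖² → 0` for every `T > 0`. Proof: split at frequency
`R` (`Torus.lintegral_enorm_sub_sq_le_sum_add`): the finitely many low modes converge for every
`t` and are uniformly bounded (dominated convergence in `t`), the tails are bounded by
`(2/(4π²R²)) ∫₀ᵀ (‖∇U n‖² + ‖∇u‖²) ≤ (4/(4π²R²)) ((∫‖u₀‖²) + 2TA)/ν`, small for `R` large. [cite: RobinsonRodrigoSadowski2016, Thm. 4.4 Step 3 (4.13), Thm. 4.11] -/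
theorem IsHopfGalerkinScheme.tendsto_lintegral_enorm_sub_sq (hS : IsHopfGalerkinScheme ν f u₀ N F U)
    (hν : 0 < ν) (hu₀ : MemLp u₀ 2 volume)
    (hfm : AEStronglyMeasurable (FunctionSpaces.Torus.stLift f) (volume.restrict (Ioi 0 ×ˢ univ)))
    (hf₂ : ∀ T, 0 < T → ∫⁻ t in Ioo 0 T, ∫⁻ x, ‖f t x‖ₑ ^ 2 < ⊤)
    (hum : AEStronglyMeasurable (FunctionSpaces.Torus.stLift u) (volume.restrict (Ioi 0 ×ˢ univ)))
    (hu : ∀ t, 0 ≤ t → MemLp (u t) 2 volume)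
    (hc : ∀ t, 0 ≤ t → ∀ k, Tendsto (fun n => mFourierCoeff (FunctionSpaces.EuclideanSpace.complexify ∘ U n t) k)
      atTop (𝓝 (mFourierCoeff (FunctionSpaces.EuclideanSpace.complexify ∘ u t) k))) {T : ℝ} (hT : 0 < T) :
    Tendsto (fun n => ∫⁻ t in Ioo 0 T, ∫⁻ x, ‖U n t x - u t x‖ₑ ^ 2) atTop (𝓝 0) := by
  obtain ⟨A, hA, hFA⟩ := hS.exists_force_bound hfm hf₂ hT
  -- the dissipation bound `D` (for the approximations and the limit) and the `L²` bound `Y`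
  set D : ℝ≥0∞ := ENNReal.ofReal (((∫ x, ‖u₀ x‖ ^ 2) + 2 * T * A.toReal) / ν) with hD
  have hDn : ∀ n, ∫⁻ t in Ioo 0 T, FunctionSpaces.Torus.eGradNormSq (U n t) ≤ D := fun n =>
    hS.lintegral_eGradNormSq_le hν hu₀ hT hA n (hFA n)
  have hDu : ∫⁻ t in Ioo 0 T, FunctionSpaces.Torus.eGradNormSq (u t) ≤ D :=
    hS.lintegral_eGradNormSq_limit_le hν hu₀ hc hT hA hFA
  obtain ⟨Y, hYdef⟩ : ∃ Y : ℝ, Y = 2 * (∫ x, ‖u₀ x‖ ^ 2) + 4 * T * A.toReal := ⟨_, rfl⟩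
  have hYn : ∀ n, ∀ t ∈ Icc 0 T, ∫ x, ‖U n t x‖ ^ 2 ≤ Y := fun n t ht =>
    (hS.integral_norm_sq_le hν.le hT hA n (hFA n) ht).trans (by
      have := hS.integral_norm_sq_zero_le hu₀ n
      rw [hYdef]; linarith)
  have hYu : ∀ t ∈ Icc 0 T, ∫ x, ‖u t x‖ ^ 2 ≤ Y := fun t ht => by
    rw [hYdef]; exact hS.integral_norm_sq_limit_le hν.le hu₀ hu hc hT hA hFA ht
  -- low modes: dominated convergence in time for each `R`
  have hlow : ∀ R : ℕ, Tendsto (fun n => ∫⁻ t in Ioo 0 T, ∑ k ∈ FunctionSpaces.Torus.freqBall R,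
      ‖mFourierCoeff (FunctionSpaces.EuclideanSpace.complexify ∘ U n t) k -
        mFourierCoeff (FunctionSpaces.EuclideanSpace.complexify ∘ u t) k‖ₑ ^ 2) atTop (𝓝 0) := by
    intro R
    have hlim : ∀ t ∈ Ioo 0 T, Tendsto (fun n => ∑ k ∈ FunctionSpaces.Torus.freqBall R,
        ‖mFourierCoeff (FunctionSpaces.EuclideanSpace.complexify ∘ U n t) k -
          mFourierCoeff (FunctionSpaces.EuclideanSpace.complexify ∘ u t) k‖ₑ ^ 2) atTop (𝓝 0) := by
      intro t ht
      have h0 : (0 : ℝ≥0∞) = ∑ k ∈ FunctionSpaces.Torus.freqBall (d := d) R, (0 : ℝ≥0∞) := by simp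
      rw [h0]
      refine tendsto_finsetSum _ fun k _ => ?_
      have h1 : Tendsto (fun n => mFourierCoeff (FunctionSpaces.EuclideanSpace.complexify ∘ U n t) k -
          mFourierCoeff (FunctionSpaces.EuclideanSpace.complexify ∘ u t) k) atTop (𝓝 0) := by
        simpa using (hc t ht.1.le k).sub_const (mFourierCoeff (FunctionSpaces.EuclideanSpace.complexify ∘ u t) k)
      have h2 : Tendsto (fun n => ‖mFourierCoeff (FunctionSpaces.EuclideanSpace.complexify ∘ U n t) k -
          mFourierCoeff (FunctionSpaces.EuclideanSpace.complexify ∘ u t) k‖ₑ ^ 2) atTop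
          (𝓝 (‖(0 : EuclideanSpace ℂ d)‖ₑ ^ 2)) :=
        ((ENNReal.continuous_pow 2).tendsto _).comp h1.enorm
      simpa using h2
    have hmeas : ∀ n, AEMeasurable (fun t => ∑ k ∈ FunctionSpaces.Torus.freqBall R,
        ‖mFourierCoeff (FunctionSpaces.EuclideanSpace.complexify ∘ U n t) k -
          mFourierCoeff (FunctionSpaces.EuclideanSpace.complexify ∘ u t) k‖ₑ ^ 2) (volume.restrict (Ioo 0 T)) := by
      intro n
      refine Finset.aemeasurable_fun_sum _ fun k _ => ?_
      refine (AEStronglyMeasurable.enorm ?_).pow_const 2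
      exact ((hS.aestronglyMeasurable_mFourierCoeff n k).mono_measure
        (Measure.restrict_mono Ioo_subset_Ioi_self le_rfl)).sub
        (FunctionSpaces.Torus.aestronglyMeasurable_mFourierCoeff_stSlice hum T k)
    -- uniform bound `#ball · 4Y`
    have hbd : ∀ n, ∀ᵐ t ∂(volume.restrict (Ioo 0 T)), ∑ k ∈ FunctionSpaces.Torus.freqBall R,
        ‖mFourierCoeff (FunctionSpaces.EuclideanSpace.complexify ∘ U n t) k -
          mFourierCoeff (FunctionSpaces.EuclideanSpace.complexify ∘ u t) k‖ₑ ^ 2 ≤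
        (FunctionSpaces.Torus.freqBall (d := d) R).card * ENNReal.ofReal (4 * Y) := by
      intro n
      filter_upwards [ae_restrict_mem measurableSet_Ioo] with t ht
      have ht' : t ∈ Icc 0 T := ⟨ht.1.le, ht.2.le⟩
      rw [← nsmul_eq_mul]
      refine Finset.sum_le_card_nsmul _ _ _ fun k _ => ?_
      refine (enorm_sub_sq_le_two_mul _ _).trans ?_
      have h1 : ‖mFourierCoeff (FunctionSpaces.EuclideanSpace.complexify ∘ U n t) k‖ₑ ^ 2 ≤ ENNReal.ofReal Y := by
        rw [← ofReal_norm, ← ENNReal.ofReal_pow (norm_nonneg _)]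
        exact ENNReal.ofReal_le_ofReal ((hS.norm_mFourierCoeff_sq_le n ht'.1 k).trans (hYn n t ht'))
      have h2 : ‖mFourierCoeff (FunctionSpaces.EuclideanSpace.complexify ∘ u t) k‖ₑ ^ 2 ≤ ENNReal.ofReal Y := by
        rw [← ofReal_norm, ← ENNReal.ofReal_pow (norm_nonneg _)]
        refine ENNReal.ofReal_le_ofReal (le_trans ?_ (hYu t ht'))
        rw [FunctionSpaces.Torus.integral_norm_sq_eq_tsum (hu t ht'.1)]
        exact (FunctionSpaces.Torus.hasSum_sq_norm_mFourierCoeff_complexify (hu t ht'.1)).summable.le_tsum k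
          (fun _ _ => sq_nonneg _)
      have hY0 : 0 ≤ Y := le_trans (integral_nonneg fun x => sq_nonneg _) (hYu t ht')
      have hY4 : ENNReal.ofReal (4 * Y) = 2 * ENNReal.ofReal Y + 2 * ENNReal.ofReal Y := by
        rw [show (4 : ℝ) * Y = 2 * Y + 2 * Y by ring, ENNReal.ofReal_add (by positivity)
          (by positivity), ENNReal.ofReal_mul zero_le_two, ENNReal.ofReal_ofNat]
      rw [hY4]
      gcongr
    have hfin : ∫⁻ _ in Ioo 0 T, ((FunctionSpaces.Torus.freqBall (d := d) R).card : ℝ≥0∞) *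
        ENNReal.ofReal (4 * Y) ≠ ⊤ := by
      rw [setLIntegral_const]
      exact ENNReal.mul_ne_top (ENNReal.mul_ne_top (ENNReal.natCast_ne_top _) ENNReal.ofReal_ne_top)
        measure_Ioo_lt_top.ne
    have h := tendsto_lintegral_of_dominated_convergence' _ hmeas hbd hfin
      ((ae_restrict_mem measurableSet_Ioo).mono hlim)
    simpa using h
  -- conclusion: `ε`-argument
  rw [ENNReal.tendsto_nhds_zero]
  intro ε hε
  -- reduce to real `δ > 0` with `ofReal δ ≤ ε`
  obtain ⟨δ, hδ, hδε⟩ : ∃ δ : ℝ, 0 < δ ∧ ENNReal.ofReal δ ≤ ε := by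
    rcases eq_or_ne ε ⊤ with h | h
    · exact ⟨1, one_pos, h ▸ le_top⟩
    · refine ⟨ε.toReal, ENNReal.toReal_pos hε.ne' h, (ENNReal.ofReal_toReal h).le⟩
  -- choose `R` with the tail `≤ δ/2`
  have hDfin : D ≠ ⊤ := ENNReal.ofReal_ne_top
  obtain ⟨R, hR⟩ := exists_nat_gt (max 1 (2 * (2 * D.toReal) / (4 * Real.pi ^ 2 * (δ / 2))))
  have hR1 : 1 ≤ R := by
    have : (1 : ℝ) < R := lt_of_le_of_lt (le_max_left _ _) hR
    exact_mod_cast this.le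
  have h1R : (1 : ℝ) ≤ R := by exact_mod_cast hR1
  have hRpos : (0 : ℝ) < R := lt_of_lt_of_le one_pos h1R
  have htailR : ENNReal.ofReal (2 / (4 * Real.pi ^ 2 * (R : ℝ) ^ 2)) * (D + D) ≤
      ENNReal.ofReal (δ / 2) := by
    rw [← ENNReal.ofReal_toReal hDfin, ← ENNReal.ofReal_add ENNReal.toReal_nonneg
      ENNReal.toReal_nonneg, ← ENNReal.ofReal_mul (by positivity)]
    refine ENNReal.ofReal_le_ofReal ?_
    have h1 : 2 * (2 * D.toReal) / (4 * Real.pi ^ 2 * (δ / 2)) < R :=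
      lt_of_le_of_lt (le_max_right _ _) hR
    have h2 : (R : ℝ) ≤ (R : ℝ) ^ 2 := by nlinarith [mul_le_mul_of_nonneg_left h1R hRpos.le]
    rw [div_mul_eq_mul_div, div_le_iff₀ (by positivity)]
    rw [div_lt_iff₀ (by positivity)] at h1
    have hD0 : 0 ≤ D.toReal := ENNReal.toReal_nonneg
    nlinarith [Real.pi_pos, mul_le_mul_of_nonneg_left h2
      (show 0 ≤ 4 * Real.pi ^ 2 * (δ / 2) by positivity)]
  -- `n` large: low modes `≤ δ/2`
  have hlowR := ENNReal.tendsto_nhds_zero.1 (hlow R) (ENNReal.ofReal (δ / 2))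
    (ENNReal.ofReal_pos.2 (by positivity))
  filter_upwards [hlowR] with n hn
  -- pointwise split, integrate
  have hsplit : ∀ t ∈ Ioo 0 T, ∫⁻ x, ‖U n t x - u t x‖ₑ ^ 2 ≤
      (∑ k ∈ FunctionSpaces.Torus.freqBall R, ‖mFourierCoeff (FunctionSpaces.EuclideanSpace.complexify ∘ U n t) k -
          mFourierCoeff (FunctionSpaces.EuclideanSpace.complexify ∘ u t) k‖ₑ ^ 2) +
        ENNReal.ofReal (2 / (4 * Real.pi ^ 2 * (R : ℝ) ^ 2)) *
          (FunctionSpaces.Torus.eGradNormSq (U n t) + FunctionSpaces.Torus.eGradNormSq (u t)) := fun t ht =>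
    Torus.lintegral_enorm_sub_sq_le_sum_add (hS.memLp_slice n ht.1.le) (hu t ht.1.le) hR1
  calc ∫⁻ t in Ioo 0 T, ∫⁻ x, ‖U n t x - u t x‖ₑ ^ 2
      ≤ ∫⁻ t in Ioo 0 T, ((∑ k ∈ FunctionSpaces.Torus.freqBall R,
          ‖mFourierCoeff (FunctionSpaces.EuclideanSpace.complexify ∘ U n t) k -
            mFourierCoeff (FunctionSpaces.EuclideanSpace.complexify ∘ u t) k‖ₑ ^ 2) +
          ENNReal.ofReal (2 / (4 * Real.pi ^ 2 * (R : ℝ) ^ 2)) *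
            (FunctionSpaces.Torus.eGradNormSq (U n t) + FunctionSpaces.Torus.eGradNormSq (u t))) :=
        setLIntegral_mono' measurableSet_Ioo hsplit
    _ ≤ (∫⁻ t in Ioo 0 T, ∑ k ∈ FunctionSpaces.Torus.freqBall R,
          ‖mFourierCoeff (FunctionSpaces.EuclideanSpace.complexify ∘ U n t) k -
            mFourierCoeff (FunctionSpaces.EuclideanSpace.complexify ∘ u t) k‖ₑ ^ 2) +
          ENNReal.ofReal (2 / (4 * Real.pi ^ 2 * (R : ℝ) ^ 2)) *
            ((∫⁻ t in Ioo 0 T, FunctionSpaces.Torus.eGradNormSq (U n t)) +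
              ∫⁻ t in Ioo 0 T, FunctionSpaces.Torus.eGradNormSq (u t)) := by
        have hm1 : AEMeasurable (fun t => FunctionSpaces.Torus.eGradNormSq (U n t)) (volume.restrict (Ioo 0 T)) :=
          hS.aemeasurable_eGradNormSq n T
        have hm2 : AEMeasurable (fun t => FunctionSpaces.Torus.eGradNormSq (u t)) (volume.restrict (Ioo 0 T)) :=
          Torus.aemeasurable_eGradNormSq_of_coeff fun k =>
            FunctionSpaces.Torus.aestronglyMeasurable_mFourierCoeff_stSlice hum T k
        have hm3 : AEMeasurable (fun t => ENNReal.ofReal (2 / (4 * Real.pi ^ 2 * (R : ℝ) ^ 2)) *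
            (FunctionSpaces.Torus.eGradNormSq (U n t) + FunctionSpaces.Torus.eGradNormSq (u t))) (volume.restrict (Ioo 0 T)) :=
          (hm1.add hm2).const_mul _
        rw [lintegral_add_right' _ hm3, lintegral_const_mul' _ _ ENNReal.ofReal_ne_top,
          lintegral_add_left' hm1]
    _ ≤ ENNReal.ofReal (δ / 2) + ENNReal.ofReal (2 / (4 * Real.pi ^ 2 * (R : ℝ) ^ 2)) * (D + D) := by
        have hDD : (∫⁻ t in Ioo 0 T, FunctionSpaces.Torus.eGradNormSq (U n t)) +
            (∫⁻ t in Ioo 0 T, FunctionSpaces.Torus.eGradNormSq (u t)) ≤ D + D := add_le_add (hDn n) hDu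
        exact add_le_add hn (by gcongr)
    _ ≤ ENNReal.ofReal (δ / 2) + ENNReal.ofReal (δ / 2) := add_le_add le_rfl htailR
    _ = ENNReal.ofReal δ := by rw [← ENNReal.ofReal_add (by positivity) (by positivity), add_halves]
    _ ≤ ε := hδε

end Friedrichs


end NS

end Literature.Analysis.FluidPDE

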